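import Literature.MathematicalPhysics.QuantumFieldTheory.BalabanImbrieJaffe1984to88.BIJ88NeumannPropagatorFlatDecay
import Literature.MathematicalPhysics.QuantumFieldTheory.Balaban1983to89.B4Thm19ZeroBoxHolder

/-!
# `BalabanImbrieJaffe1984to88.BIJ88NeumannPropagatorFlatDecayCube` — T. Bałaban, J. Imbrie, A. Jaffe, *Effective action and cluster
properties of the abelian Higgs model*, Commun. Math. Phys. **114** (1988) 257–315 [BalabanImbrieJaffe1988], Sect. 2 p. 262–263 [PDF 6–7],
(2.27)/(2.30): **[6]'s DECAY THEOREM (1.10) (VALUE AND COVARIANT-DERIVATIVE MEMBERS) AND (1.9) (HÖLDER MEMBER) FOR THE CUBE NEUMANN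
PROPAGATORS OF RECORD `G_k(□,u)` AT EVERY PURE-GAUGE BACKGROUND `u = 1^h`** — hypothesis-free, in the printed SUP-NORM shape, constants depending on `(d, L, a)` only (uniform in the volume, in the
cube, in the level `1 ≤ k ≤ K` and in the gauge function `h`); companion of `BIJ88NeumannPropagatorFlatDecay` (the whole-torus member).

statement-level skeleton of published theorems with citation tags; proofs where landed; nothing here is a claim about the Yang–Mills mass gap

PDF held: `paper:balaban1988-cmp114-bij-abelian-higgs-effective-action` (journal page = PDF page + 256); p. 262–263 [PDF 6–7] re-read this
session (text layer); [I] = [BalabanImbrieJaffe1985] (CMP **97**) p. 326 [PDF 28]; [6] = [7] of [I] = [Balaban1983RegularityDecay] (CMP **89**)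
p. 572–573 [PDF 2–3] (text layer re-read this session, p. 572) as transcribed in the tree's `Balaban1983to89.B4Thm110ZeroBox` /
`B4Thm110ZeroBoxDeriv` / `B4Thm19ZeroBoxHolder` (zero-field BOX theorems: value / difference-quotient / Hölder members) and `B4BoxCov237` (`boxOpR`).
v1.1 (append-only): §6 — the covariant-derivative member `decay110_flat_cube_deriv` (+ `gBox_cube_pureGauge_mulVec`, `covD_gBox_cube_pureGauge`);
§7 — the kernel decay of gen 15's (2.27) `gTilde` / (2.28) `gLocT` over families of such cubes (`decay_gTilde_flat_kernel`, `decay_gLocT_flat_kernel`);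
§8 — the Hölder member (1.9) `holder19_flat_cube` (+ `T_cubePt_eq`); import `B4Thm110ZeroBox` ↦ `B4Thm19ZeroBoxHolder` (→ `B4Thm110ZeroBoxDeriv` →
`B4Thm110ZeroBox`); §§1–5 verbatim.

CITATION HEADER (lean-in-tree rule).  Part of the lit-balaban TYPED SKELETON (HOME `run/shared/lean/pub/lit-balaban/`), PHASE-2 proof seat
p31 gen 16 (unit `lit-balaban-p31-g16`; TAKING line HOME/STATUS.md 2026-08-22T13:13:57Z, item «NEXT (same TAKING, second bridge)» of its 13:54:02Z VERDICT line;
free-target protocol G.5-34(d) — successor item (a) of this seat's gen-15 HANDOFF = item 2 (ii) of the owner's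
`HOME/lit-balaban-r18/C2S14-CLOSURE.md` §5, *"the DECAY inputs (2.30)/(2.31) … [6]'s Theorem for p31's concrete `gBox`"*, FLAT-BACKGROUND
case, CUBE member).  WHAT IS REPRODUCED: the [6]-input of row **C2.Eq2.30** (`HOME/lit-balaban-r18/ROWS-C2.md`, owner r18: *"[6]'s propagator
estimates stay displayed hypotheses"*) for the CUBE propagators `G_k(□_α,u)` of row **C2.Eq2.27** — at pure-gauge backgrounds, value and covariant-derivative members
(row **C2.Claim@263** *"Bounds analogous to (2.30), (2.31) hold for covariant derivatives"*, input shape) — and the kernel decay of the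
convex combination (2.27) `G̃_k` and of (2.28) `G_{k,loc}` themselves (rows **C2.Eq2.27** / **C2.Eq2.28**, gen 15's `gTilde`/`gLocT`) at flat `u`.
Kind «model-level definitions (the cube chart) + theorems» (no `Prop`-valued fact introduced).

THE PRINTED TEXT (verbatim).  C2 p. 262–263 [PDF 6–7]: *"In the scalar field sector, we have the η-lattice propagators G_k(Ω,u) defined on
subsets Ω ⊂ T_η with Neumann boundary conditions. To localize the dependence on u, we interpolate in a smooth fashion between operators with
Neumann boundary conditions on small cubes. Let {□_α} be the collection of r(e_k)-cubes that can be built from cubes of size M = O(1) as in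
[6]. Define G_k(u;x₁,x₂) = Σ_α h_α G_k(□_α,u;x₁,x₂) (2.27) as a convex combination of Neumann propagators. … a straightforward application of
the random walk expansion of [6] shows that |(G_{k,loc}(u)f)(x)| ≤ ce^{−c dist(suppt f, x)}‖f‖_∞, (2.30)"*.  [I] p. 326 [PDF 28]: *"by change
of gauge u_k can be transformed in a local region Λ into a configuration of the form exp[ie_kηA], where A is smooth and small."*  [6] p. 573
[PDF 3] (as transcribed in `B4Thm110ZeroBox`): *"Theorem (Proposition 2.1 of [1]). … |(D^η_{A,μ}G_k(Ω, A)f)(x)|, |(G_k(Ω, A)f)(x)| ≤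
c₀exp(−δ₀ dist(x, supp f))‖f‖_∞ (1.10) … For some simple sets Ω, e.g. for rectangular parallelepipeds, the inequalities hold without any
restrictions on the points x, x′"*.

THE OBJECTS.  `G_k(□,u)` = this seat's gen-15 `BIJ88NeumannPropagator227Torus.gBox a c U k □` for a finite union `□` of `k`-blocks of the fine
torus `Site P 0` (`(−Δ^N_{u,□} + a·Q_k(u)|_□ᴴQ_k(u)|_□ + 1_{□ᶜ})⁻¹·1_□`), here at the parameters of record `c = ε⁻¹`, `a = α_kL^{k(d+1)}`
(`α_k = a_k(L^kε)^{−2}` = pv07's `B1RG242Torus.α P a k`, `a_k = B1.aSeq a L k` the running coefficient of [I] (2.16)) — see the companion file's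
header for why these are the printed operator in gen 15's counting normalization.  THE CUBE CHART (§1): for a corner `c : Fin (d+1) → ℕ` (in units
of `n = L^k`) and side multiples `M`, `cubePt hPd n c z` is the fine-torus site with coordinates `c_i·n + z_i` (directions `μ ↔ i` through
`hPd : P.d = d + 1`), `boxCoord` its inverse on the cube and `cubeT hPd n c N = cubePt(Π_i[0, N_i))` — with `N_i = nM_i` this is the cube
`□ = c·L^k + Π_i[0, L^kM_i)` of `T^{(0)}`, a union of `k`-blocks (`isBlockUnion_cubeT`); the box `Π_i[0,N_i) ⊂ ℤ^{d+1}` is b04's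
`B4Reflection242.boxDom N`, the carrier of [6]'s box operators in the tree.  [6]'s ZERO-FIELD BOX OPERATOR: b04/p38's REAL matrix
`B4BoxCov237.boxOpR n a_k m² M = n²(−Δ^N_□) + m² + a_k n^{−(d+1)}1_{same n-block}` on `boxDom (nM)` ([6] (1.6)/(2.44) in lattice units), whose
inverse is the subject of p38's `B4Thm110ZeroBox.thm110_zero_box_value` ((1.10), value clause, *"for rectangular parallelepipeds … without any
restrictions on the points"*).

THE MECHANISM ([I] p. 326 *"by change of gauge"*, `A = 0`).  (§2) Chart geometry without wrap-around: for a cube that FITS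
(`c_i n + N_i ≤ |T|`, labels read in `[0,|T|)`) and is SHORTER THAN THE TORUS (`N_i < |T|`, so that `x ± e_μ` leaves the cube exactly when
`z ± e_i` leaves the box), unit steps, membership and `k`-blocks correspond under the chart (`shift_cubePt_mem_iff`, `cubePt_eq_shift_iff`,
`blkIter_cubePt_eq_iff`: same `k`-block ⟺ same `n`-block `blk n z = blk n z′` of b04).  (§3) ENTRYWISE OPERATOR BRIDGE: at `u = 1` the Neumann-cut
Laplacian Gram matrix of a region counts, per direction, the bonds `⟨x,x+e_μ⟩`, `⟨x−e_μ,x⟩` inside the region (`gram_dN_flat_region_apply`),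
which under the chart is [6]'s box Neumann Laplacian `−Δ^N_□(z,z′)` = (number of box neighbours) on the diagonal, `−1` on box neighbours
(`neumannLapK_eq_sum`, `lapSum_cubePt`); the block Gram matrix is `L^{−2k(d+1)}·[same k-block]` (`gram_qMatK_flat_region_apply`); whence
**`nOp_cube_apply`**: `nOp (α_kL^{k(d+1)}) ε⁻¹ 1 k □ (c·n+z, c·n+z′) = (L^kε)^{−2}·boxOpR (L^k) a_k 0 M (z,z′)`.  (§4) UNIQUENESS OF THE INVERSE
(gen 15 `eq_gBox_of_left_inverse`, b04 `boxOpR_inv_mul`): **`gBox_cube_eq`**: `G_k(□,1) = (L^kε)²·(boxOpR (L^k) a_k 0 M)⁻¹` through the chart on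
`□ × □`, `0` elsewhere (the real matrix `gCubeR`, read in `ℂ`); gauge covariance (gen 15 `gBox_gaugeAct`): **`gBox_cube_pureGauge`**:
`G_k(□,1^h) = M_h·G_k(□,1)·M_hᴴ`.  (§5) p38's `thm110_zero_box_value` (window `a₋ = a₊ = a`, `m² = 0`) applied to the real and imaginary parts
of the rotated source `h̄f` read in the box; the torus sup-distance between cube points is at most the box sup-distance (`T_cubePt_le`), and
`(L^kε)² ≤ 1`, `e^{−δ₀D/L^k} ≤ e^{−δ₀εD}` for `k ≤ K`, `D ≥ 0`.  (§6, v1.1) The covariant derivative at `u = 1^h` across a bond `⟨x, x+e_μ⟩` of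
the cube is `h(x)·ε⁻¹(ψ(x+e_μ) − ψ(x))`, `ψ = G_k(□,1)(h̄f)` (`covD_gBox_cube_pureGauge`), and `ε⁻¹(L^kε)²·(…) = (L^kε)·L^k(…)` is p38's
`B4Thm110ZeroBoxDeriv.thm110_zero_box_deriv_value` (the `η`-difference-quotient member of (1.10)) times `L^kε ≤ 1`.  (§8, v1.1) The same reduction for the
second difference `δψ(x₂) − δψ(x₁)` after removing the phases `h(x₁)h(x₂)^{−1}·h(x₂) = h(x₁)`, and p38's
`B4Thm19ZeroBoxHolder.thm19_zero_box_holder_value` with its weight `(L^k/|z₂−z₁|_∞)^α` (`= (L^k/|x₁−x₂|_T)^α` by `T_cubePt_eq`).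

WHAT IS PROVED (0 `sorry`; standard axioms; no `Prop`-valued fact).  Definitions with bodies: `cubePt`, `boxCoord`, `cubeT` (§1), `boxInvR`,
`gCubeR` (§4).  Theorems: §1 `val_cubePt`, `boxCoord_cubePt`, `cubePt_injOn`, `mem_cubeT`, `cubePt_mem_cubeT`, `cubePt_boxCoord`,
`mem_cubeT_iff_val`; §2 `cubePt_add_single`, `cubePt_sub_single`, `cubePt_inj_of_abs_lt`, `shift_cubePt_mem_iff`, `unshift_cubePt_mem_iff`,
`cubePt_eq_shift_iff`, `cubePt_eq_unshift_iff`, `blkIter_cubePt_eq_iff`, **`isBlockUnion_cubeT`**; §3 `dN_flat_region_apply`,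
`gram_dN_flat_region_apply`, `qMatK_flat_region_apply`, `gram_qMatK_flat_region_apply`, `nOp_flat_region_apply` (any region / block union, any
level `j`), `neumannLapK_eq_sum`, `cubePt_eq_iff`, `lapSum_cubePt`, **`nOp_cube_apply`**; §4 `boxInvR_of_mem`, `gCubeR_apply_of_not_mem_left/right`,
`gCubeR_apply_cubePt`, `sum_cubeT`, `gCubeR_mulVec_cubePt`, `gCubeR_mulVec_of_not_mem`, `nOp_apply_of_not_mem_right`, `gCubeR_mul_proj`,
`gCubeR_mul_nOp`, **`gBox_cube_eq`**, `gBox_cube_apply_cubePt`, **`gBox_cube_pureGauge`**; §5 `T_cubePt_le`, **`decay110_flat_cube`** — (1.10),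
value member, for `G_k(□,1^h)`: `∃ δ₀ c₀ > 0` (from `(d, ℓ, a)`, `L = ℓ + 1`) such that for every volume `P` with `P.d = d + 1`, `P.L = ℓ + 1`,
every `1 ≤ k ≤ K`, every cube `□ = c·L^k + Π_i[0, L^kM_i)` with `M_i ≥ 1` that fits and is shorter than the torus, every `h : T^{(0)} → U(1)`,
every `x`, every complex source `f` with `‖f‖ ≤ F` supported at sup-torus distance `≥ D ≥ 0` (lattice units) from `x`:
`‖(G_k(□,1^h)f)(x)‖ ≤ c₀e^{−δ₀εD}F`; **`decay110_flat_cube_kernel`** — `‖G_k(□,1^h; x, y)‖ ≤ c₀e^{−δ₀ε|x−y|_T}`; §6 (v1.1)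
`gBox_cube_pureGauge_mulVec`, `covD_gBox_cube_pureGauge`, **`decay110_flat_cube_deriv`** — for the same data and every bond `⟨x, x+e_μ⟩` with both
end-points in `□`: `‖ε⁻¹(u_{⟨x,x+e_μ⟩}(G f)(x+e_μ) − (G f)(x))‖ ≤ c₀e^{−δ₀εD}F` (`u = 1^h`, r18's `covD`; its own `δ₀, c₀` from `(d, ℓ, a)`).
§7 (v1.1) **`decay_gTilde_flat_kernel`** / **`decay_gLocT_flat_kernel`** — for gen 15's torus objects of record `BIJ88DeltaLoc234Torus.gTilde` (2.27)
and `gLocT` (2.28) over ANY finite family of such cubes `□_α` at level `k`, ANY real weights with `Σ_α|λ_α(x₁,x₂)| ≤ 1` and ANY cut-off `|ζ″| ≤ 1`: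
`‖G̃_k(1^h;x₁,x₂)‖, ‖G_{k,loc}(1^h;x₁,x₂)‖ ≤ c₀e^{−δ₀ε|x₁−x₂|_T}` (the *"|G(x,y)| ≤ Ae^{−c dist}"* input shape of p02's (2.30) hence-step
`BIJ88OpDecay230Proof`, with `k`-uniform `A = c₀`).  §8 (v1.1) `T_cubePt_eq` (for a cube shorter than HALF the torus the sup TORUS distance of two cube points IS their box
sup distance), **`holder19_flat_cube`** — (1.9): for every `0 ≤ α < 1`, `∃ δ₀ c₀ > 0` (from `(d, ℓ, a, α)`) such that for the same data with
`2L^kM_i ≤ |T|`, every `μ`, all `x₁ ≠ x₂` with both bonds `⟨x_i, x_i+e_μ⟩` in `□` and both points at sup-torus distance `≥ D` from `supp f`: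
`(L^k/|x₁−x₂|_T)^α·‖h(x₁)h(x₂)^{−1}(D_uG f)(x₂,μ) − (D_uG f)(x₁,μ)‖ ≤ c₀e^{−δ₀εD}F` (pure-gauge transport `u(Γ_{x₁x₂}) = h(x₁)h(x₂)^{−1}` written out;
`|x₁−x₂|_T/L^k` = the printed distance in [6]'s level-`k` units, `= ε|x₁−x₂|_T` at the unit block lattice `k = K`).
HONEST SCOPE.  (i) FLAT BACKGROUNDS ONLY (`A = 0` up to gauge), as in the companion file (at (1.7)-regular `A ≠ 0` B4's box family
`B4ThmBoxPairEta` averages along staircase contours, not the composite contours of `Q_k(u)`; not obtained here).  (ii) Members: value §5; covariant derivative §6 and Hölder §8 on bonds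
INSIDE the cube (across a boundary bond the Neumann-cut derivative is not the object of (1.9)/(1.10)); §8 for cubes shorter than half the
torus (torus = box distance) with the weight `(L^k/|x₁−x₂|_T)^α` of [6]'s level-`k` units (p38's torus theorem and the companion file use
`(ε|x₁−x₂|_T)^{−α}`, the same at `k = K`).  (iii) Cubes that do not wrap around the torus and are shorter than it in every direction (`hfit`, `hN`) — the r(e_k)-cubes `□_α` of
(2.27) are small against `T_η`; wrapped placements are the same cubes after a translation of the torus coordinates, not spelled out.  (iv) Fine
level `j = 0`, `1 ≤ k ≤ K`, `m² = 0`, window `a₋ = a₊ = a`; sup TORUS metric `B5Ineq137Torus.T` in lattice units for the support condition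
(dominated by the box metric, so the printed `dist(x, supp f)` in the box is `≥ εD`); complex sources, constant `2c₀`.
Imports: the companion `BIJ88NeumannPropagatorFlatDecay` (→ gen 15 `BIJ88NeumannPropagator227Torus`/`BIJ88DeltaLoc234Torus`, p33
`BIJ85BlockKPoincare`, p38 `B4Thm19ZeroTorus`), p38's `Balaban1983to89.B4Thm19ZeroBoxHolder` (→ `B4Thm110ZeroBoxDeriv` → `B4Thm110ZeroBox`, b04
`B4BoxCov237`, `B4Reflection242`, `B4Green242Bridge`, `B4ContourShift.supNorm`).  Literature + Mathlib only.
Unit `lit-balaban-p31` (literature-prover-lit-balaban-p31-g16-0), 2026-08-22.  NOT summit progress.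
-/

open scoped BigOperators Matrix ComplexConjugate
open Finset Matrix

namespace Literature.MathematicalPhysics.QuantumFieldTheory.BalabanImbrieJaffe1984to88.BIJ88NeumannPropagatorFlatDecayCube

open Literature.MathematicalPhysics.QuantumFieldTheory.Balaban1983to89
open BIJ88Sect3Statements (U1 toC cfg covD starB mem_starB toC_mul toC_one toC_inv norm_toC)
open BIJ85Sect1Model (HiggsField)
open BIJ85BlockAveragesTorus BIJ85BlockAveragesTorusK
open BIJ85BlockAveragingIneq (lineIter_one deltaAx_one sum_bond_eq)
open BIJ85BlockKPoincare (val_blkIter)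
open BIJ88Vj5610Operator (dMat qMat chiN hMat)
open BIJ88NeumannNoZeroModesTorus (IsBlockUnion isBlockUnion_univ)
open BIJ88NeumannPropagator227Torus
open BIJ88DeltaLoc234Torus (mulOp gBox_gaugeAct gBox_gaugeAct_apply)
open BIJ88NeumannPropagatorFlatDecay
open B4Reflection242 (boxDom mem_boxDom nbrs mem_nbrs blk not_mem_nbrs_self card_nbrs neumannLapK diagK avgK)
open B4ContourShift (supNorm abs_le_supNorm supNorm_nonneg)
open B4BoxCov237 (boxOpR opBoxR boxOpR_isUnit boxOpR_mul_inv boxOpR_inv_mul)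
open GaugeField (gaugeAct)

noncomputable section

variable {d : ℕ} {P : Params}

/-! ## §1 The cube chart: a box `Π_i[0, N_i) ⊂ ℤ^{d+1}` placed at the corner `c·n` of the fine torus `T^{(0)}` -/

/-- The fine-torus site with coordinates `c_i·n + z_i` (`i ↔ μ` through `P.d = d + 1`): the CHART placing the box `Π_i[0, N_i)` of
[6]'s box theorems at the corner `c·n` of the torus of record. [cite: Balaban1983RegularityDecay, p.572 «subsets of a torus T_η which we identify with a rectangular parallelepiped», dictionary] -/
def cubePt (hPd : P.d = d + 1) (n : ℕ) (c : Fin (d + 1) → ℕ) (z : Fin (d + 1) → ℤ) : Balaban1983to89.Site P 0 :=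
  fun μ => (((((c (Fin.cast hPd μ) * n : ℕ) : ℤ) + z (Fin.cast hPd μ) : ℤ) : ℤ) : ZMod (P.sitesPerDir 0))

/-- The box coordinates of a fine-torus site relative to the corner `c·n`: `z_i = x_μ − c_i·n` (labels read in `[0, |T|)`).
[cite: Balaban1983RegularityDecay, p.572, dictionary] -/
def boxCoord (hPd : P.d = d + 1) (n : ℕ) (c : Fin (d + 1) → ℕ) (x : Balaban1983to89.Site P 0) : Fin (d + 1) → ℤ :=
  fun i => ((x (Fin.cast hPd.symm i)).val : ℤ) - ((c i * n : ℕ) : ℤ)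

/-- **The cube `□ = c·n + Π_i[0, N_i)` of the fine torus** (a rectangular parallelepiped of `T_η` built of `k`-blocks when `n = L^k` and
`n ∣ N_i`): the image of the box under the chart. [cite: BalabanImbrieJaffe1988, (2.27) p.263] -/
def cubeT (hPd : P.d = d + 1) (n : ℕ) (c : Fin (d + 1) → ℕ) (N : Fin (d + 1) → ℕ) : Finset (Balaban1983to89.Site P 0) :=
  (boxDom N).image (cubePt hPd n c)

section Chart

variable (hPd : P.d = d + 1) {n : ℕ} {c N : Fin (d + 1) → ℕ}

/-- kernel: `Fin.cast` round trip. [folklore] -/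
private theorem cast_cast (i : Fin (d + 1)) : Fin.cast hPd (Fin.cast hPd.symm i) = i := by
  ext; rfl

/-- kernel: `Fin.cast` round trip, other direction. [folklore] -/
private theorem cast_cast' (μ : Fin P.d) : Fin.cast hPd.symm (Fin.cast hPd μ) = μ := by
  ext; rfl

/-- kernel: **the labels of a chart point**: `(cubePt z)_μ = c_i·n + z_i` read in `[0, |T|)`, for box points of a cube that fits,
`c_i·n + N_i ≤ |T^{(0)}|`. [cite: Balaban1983RegularityDecay, p.572, dictionary] -/
theorem val_cubePt (hfit : ∀ i, c i * n + N i ≤ P.sitesPerDir 0) {z : Fin (d + 1) → ℤ} (hz : z ∈ boxDom N) (μ : Fin P.d) :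
    (((cubePt hPd n c z) μ).val : ℤ) = (c (Fin.cast hPd μ) * n : ℕ) + z (Fin.cast hPd μ) := by
  set i := Fin.cast hPd μ
  obtain ⟨h0, hN⟩ := (mem_boxDom.1 hz) i
  have hfi := hfit i
  have hlt : ((c i * n : ℕ) : ℤ) + z i < P.sitesPerDir 0 := by push_cast at hfi ⊢; omega
  obtain ⟨m, hm⟩ := Int.eq_ofNat_of_zero_le (show (0 : ℤ) ≤ ((c i * n : ℕ) : ℤ) + z i by positivity)
  show (((((c i * n : ℕ) : ℤ) + z i : ℤ) : ZMod (P.sitesPerDir 0)).val : ℤ) = _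
  rw [hm, Int.cast_natCast, ZMod.val_natCast, Nat.mod_eq_of_lt (by exact_mod_cast (hm ▸ hlt))]

/-- kernel: the chart is inverted by the box coordinates on the box. [cite: Balaban1983RegularityDecay, p.572, dictionary] -/
theorem boxCoord_cubePt (hfit : ∀ i, c i * n + N i ≤ P.sitesPerDir 0) {z : Fin (d + 1) → ℤ} (hz : z ∈ boxDom N) :
    boxCoord hPd n c (cubePt hPd n c z) = z := by
  funext i
  rw [boxCoord, val_cubePt hPd hfit hz, cast_cast]
  ring

/-- kernel: the chart is injective on the box. [cite: Balaban1983RegularityDecay, p.572, dictionary] -/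
theorem cubePt_injOn (hfit : ∀ i, c i * n + N i ≤ P.sitesPerDir 0) :
    Set.InjOn (cubePt hPd n c) (boxDom N : Set (Fin (d + 1) → ℤ)) := by
  intro z hz z' hz' h
  rw [← boxCoord_cubePt hPd hfit (Finset.mem_coe.1 hz), ← boxCoord_cubePt hPd hfit (Finset.mem_coe.1 hz'), h]

/-- kernel: membership in the cube. [cite: BalabanImbrieJaffe1988, (2.27) p.263] -/
theorem mem_cubeT {x : Balaban1983to89.Site P 0} : x ∈ cubeT hPd n c N ↔ ∃ z ∈ boxDom N, cubePt hPd n c z = x := by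
  rw [cubeT, Finset.mem_image]

/-- kernel: chart points of box points lie in the cube. [cite: BalabanImbrieJaffe1988, (2.27) p.263] -/
theorem cubePt_mem_cubeT {z : Fin (d + 1) → ℤ} (hz : z ∈ boxDom N) : cubePt hPd n c z ∈ cubeT hPd n c N :=
  (mem_cubeT hPd).2 ⟨z, hz, rfl⟩

/-- kernel: a cube point is the chart point of its box coordinates. [cite: Balaban1983RegularityDecay, p.572, dictionary] -/
theorem cubePt_boxCoord (hfit : ∀ i, c i * n + N i ≤ P.sitesPerDir 0) {x : Balaban1983to89.Site P 0} (hx : x ∈ cubeT hPd n c N) :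
    boxCoord hPd n c x ∈ boxDom N ∧ cubePt hPd n c (boxCoord hPd n c x) = x := by
  obtain ⟨z, hz, rfl⟩ := (mem_cubeT hPd).1 hx
  rw [boxCoord_cubePt hPd hfit hz]
  exact ⟨hz, rfl⟩

/-- kernel: **the labels of a cube point**: `x ∈ □ ↔ c_i·n ≤ x_μ < c_i·n + N_i` for all `μ`. [cite: BalabanImbrieJaffe1988, (2.27) p.263] -/
theorem mem_cubeT_iff_val (hfit : ∀ i, c i * n + N i ≤ P.sitesPerDir 0) (x : Balaban1983to89.Site P 0) :
    x ∈ cubeT hPd n c N ↔ ∀ μ, c (Fin.cast hPd μ) * n ≤ (x μ).val ∧ (x μ).val < c (Fin.cast hPd μ) * n + N (Fin.cast hPd μ) := by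
  constructor
  · intro hx μ
    obtain ⟨z, hz, rfl⟩ := (mem_cubeT hPd).1 hx
    have hv := val_cubePt hPd hfit hz μ
    obtain ⟨h0, hN⟩ := (mem_boxDom.1 hz) (Fin.cast hPd μ)
    constructor <;> omega
  · intro h
    refine (mem_cubeT hPd).2 ⟨boxCoord hPd n c x, ?_, ?_⟩
    · rw [mem_boxDom]
      intro i
      have hi := h (Fin.cast hPd.symm i)
      rw [cast_cast] at hi
      simp only [boxCoord]
      constructor <;> push_cast <;> omega
    · funext μ
      simp only [cubePt, boxCoord, cast_cast']
      have hμ := h μ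
      have e : (((c (Fin.cast hPd μ) * n : ℕ) : ℤ) + (((x μ).val : ℤ) - ((c (Fin.cast hPd μ) * n : ℕ) : ℤ)) : ℤ) = ((x μ).val : ℤ) := by ring
      rw [e, Int.cast_natCast, ZMod.natCast_zmod_val]

end Chart

section ChartGeometry

variable (hPd : P.d = d + 1) {n : ℕ} {c N : Fin (d + 1) → ℕ}

/-- kernel: a unit step in the box is a unit step on the torus: `cubePt (z + e_i) = cubePt z + e_μ`. [cite: Balaban1983RegularityDecay, p.572, dictionary] -/
theorem cubePt_add_single (z : Fin (d + 1) → ℤ) (i : Fin (d + 1)) :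
    cubePt hPd n c (z + Pi.single i 1) = (cubePt hPd n c z).shift (Fin.cast hPd.symm i) := by
  funext ν
  simp only [cubePt, Balaban1983to89.Site.shift, Function.update_apply, Pi.add_apply]
  by_cases h : ν = Fin.cast hPd.symm i
  · subst h
    rw [if_pos rfl, cast_cast, Pi.single_eq_same]
    push_cast; ring
  · have hi : Fin.cast hPd ν ≠ i := fun e => h (by rw [← e, cast_cast'])
    rw [if_neg h, Pi.single_eq_of_ne hi, add_zero]

/-- kernel: `cubePt (z − e_i) = cubePt z − e_μ`. [cite: Balaban1983RegularityDecay, p.572, dictionary] -/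
theorem cubePt_sub_single (z : Fin (d + 1) → ℤ) (i : Fin (d + 1)) :
    cubePt hPd n c (z - Pi.single i 1) = (cubePt hPd n c z).unshift (Fin.cast hPd.symm i) := by
  funext ν
  simp only [cubePt, Balaban1983to89.Site.unshift, Function.update_apply, Pi.sub_apply]
  by_cases h : ν = Fin.cast hPd.symm i
  · subst h
    rw [if_pos rfl, cast_cast, Pi.single_eq_same]
    push_cast; ring
  · have hi : Fin.cast hPd ν ≠ i := fun e => h (by rw [← e, cast_cast'])
    rw [if_neg h, Pi.single_eq_of_ne hi, sub_zero]

/-- kernel: **the chart separates points whose coordinates differ by less than a period**. [cite: Balaban1983RegularityDecay, p.572, dictionary] -/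
theorem cubePt_inj_of_abs_lt {z z' : Fin (d + 1) → ℤ} (hzz : ∀ i, |z i - z' i| < P.sitesPerDir 0)
    (h : cubePt hPd n c z = cubePt hPd n c z') : z = z' := by
  funext i
  have hμ := congrFun h (Fin.cast hPd.symm i)
  simp only [cubePt, cast_cast] at hμ
  rw [ZMod.intCast_eq_intCast_iff_dvd_sub] at hμ
  have hdvd : (P.sitesPerDir 0 : ℤ) ∣ z' i - z i := by
    have e : ((c i * n : ℕ) : ℤ) + z' i - (((c i * n : ℕ) : ℤ) + z i) = z' i - z i := by ring
    rw [← e]; exact hμ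
  have h0 : z' i - z i = 0 := Int.eq_zero_of_abs_lt_dvd hdvd (by rw [abs_sub_comm]; exact hzz i)
  omega

/-- kernel: coordinates of two points of boxes that fit in the torus differ by less than a period. [folklore] -/
private theorem abs_lt_of_mem {z z' : Fin (d + 1) → ℤ} (hN : ∀ i, N i < P.sitesPerDir 0) (i : Fin (d + 1))
    (hz : 0 ≤ z i ∧ z i ≤ N i) (hz' : 0 ≤ z' i ∧ z' i < N i) : |z i - z' i| < P.sitesPerDir 0 := by
  have := hN i
  rw [abs_lt]; constructor <;> omega

/-- kernel: **`cubePt z + e_μ ∈ □ ↔ z + e_i ∈ box`** (the cube is shorter than the torus in every direction, `N_i < |T|`).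
[cite: BalabanImbrieJaffe1988, (2.27) p.263] -/
theorem shift_cubePt_mem_iff (hN : ∀ i, N i < P.sitesPerDir 0) {z : Fin (d + 1) → ℤ} (hz : z ∈ boxDom N) (μ : Fin P.d) :
    (cubePt hPd n c z).shift μ ∈ cubeT hPd n c N ↔ z + Pi.single (Fin.cast hPd μ) 1 ∈ boxDom N := by
  have e : (cubePt hPd n c z).shift μ = cubePt hPd n c (z + Pi.single (Fin.cast hPd μ) 1) := by
    rw [cubePt_add_single, cast_cast']
  rw [e]
  constructor
  · intro h
    obtain ⟨z', hz', hzz'⟩ := (mem_cubeT hPd).1 h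
    have heq : z' = z + Pi.single (Fin.cast hPd μ) 1 := by
      refine cubePt_inj_of_abs_lt hPd (fun i => ?_) hzz'
      have h1 := (mem_boxDom.1 hz') i
      have h2 := (mem_boxDom.1 hz) i
      rw [abs_sub_comm]
      refine abs_lt_of_mem hN i ?_ h1
      rw [Pi.add_apply]
      by_cases hi : i = Fin.cast hPd μ
      · subst hi; rw [Pi.single_eq_same]; omega
      · rw [Pi.single_eq_of_ne hi]; omega
    rwa [heq] at hz'
  · exact fun h => cubePt_mem_cubeT hPd h

/-- kernel: **`cubePt z − e_μ ∈ □ ↔ z − e_i ∈ box`**. [cite: BalabanImbrieJaffe1988, (2.27) p.263] -/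
theorem unshift_cubePt_mem_iff (hN : ∀ i, N i < P.sitesPerDir 0) {z : Fin (d + 1) → ℤ} (hz : z ∈ boxDom N) (μ : Fin P.d) :
    (cubePt hPd n c z).unshift μ ∈ cubeT hPd n c N ↔ z - Pi.single (Fin.cast hPd μ) 1 ∈ boxDom N := by
  have e : (cubePt hPd n c z).unshift μ = cubePt hPd n c (z - Pi.single (Fin.cast hPd μ) 1) := by
    rw [cubePt_sub_single, cast_cast']
  rw [e]
  constructor
  · intro h
    obtain ⟨z', hz', hzz'⟩ := (mem_cubeT hPd).1 h
    have heq : z' = z - Pi.single (Fin.cast hPd μ) 1 := by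
      refine cubePt_inj_of_abs_lt hPd (fun i => ?_) hzz'
      have h1 := (mem_boxDom.1 hz') i
      have h2 := (mem_boxDom.1 hz) i
      have := hN i
      rw [Pi.sub_apply]
      by_cases hi : i = Fin.cast hPd μ
      · subst hi; rw [Pi.single_eq_same, abs_lt]; constructor <;> omega
      · rw [Pi.single_eq_of_ne hi, sub_zero, abs_lt]; constructor <;> omega
    rwa [heq] at hz'
  · exact fun h => cubePt_mem_cubeT hPd h

/-- kernel: **box points are torus neighbours in direction `μ` iff they are box neighbours in direction `i`**: `cubePt z′ = cubePt z + e_μ ↔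
z′ = z + e_i`. [cite: Balaban1983RegularityDecay, p.572, dictionary] -/
theorem cubePt_eq_shift_iff (hN : ∀ i, N i < P.sitesPerDir 0) {z z' : Fin (d + 1) → ℤ} (hz : z ∈ boxDom N) (hz' : z' ∈ boxDom N)
    (μ : Fin P.d) : cubePt hPd n c z' = (cubePt hPd n c z).shift μ ↔ z' = z + Pi.single (Fin.cast hPd μ) 1 := by
  rw [show (cubePt hPd n c z).shift μ = cubePt hPd n c (z + Pi.single (Fin.cast hPd μ) 1) by rw [cubePt_add_single, cast_cast']]
  constructor
  · intro h
    refine cubePt_inj_of_abs_lt hPd (fun i => ?_) h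
    have h1 := (mem_boxDom.1 hz') i
    have h2 := (mem_boxDom.1 hz) i
    have := hN i
    rw [Pi.add_apply]
    by_cases hi : i = Fin.cast hPd μ
    · subst hi; rw [Pi.single_eq_same, abs_lt]; constructor <;> omega
    · rw [Pi.single_eq_of_ne hi, add_zero, abs_lt]; constructor <;> omega
  · intro h; rw [h]

/-- kernel: `cubePt z′ = cubePt z − e_μ ↔ z′ = z − e_i`. [cite: Balaban1983RegularityDecay, p.572, dictionary] -/
theorem cubePt_eq_unshift_iff (hN : ∀ i, N i < P.sitesPerDir 0) {z z' : Fin (d + 1) → ℤ} (hz : z ∈ boxDom N) (hz' : z' ∈ boxDom N)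
    (μ : Fin P.d) : cubePt hPd n c z' = (cubePt hPd n c z).unshift μ ↔ z' = z - Pi.single (Fin.cast hPd μ) 1 := by
  rw [show (cubePt hPd n c z).unshift μ = cubePt hPd n c (z - Pi.single (Fin.cast hPd μ) 1) by rw [cubePt_sub_single, cast_cast']]
  constructor
  · intro h
    refine cubePt_inj_of_abs_lt hPd (fun i => ?_) h
    have h1 := (mem_boxDom.1 hz') i
    have h2 := (mem_boxDom.1 hz) i
    have := hN i
    rw [Pi.sub_apply]
    by_cases hi : i = Fin.cast hPd μ
    · subst hi; rw [Pi.single_eq_same, abs_lt]; constructor <;> omega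
    · rw [Pi.single_eq_of_ne hi, sub_zero, abs_lt]; constructor <;> omega
  · intro h; rw [h]

/-- kernel: **the `k`-blocks agree under the chart** (`n = L^k`, corner `c·L^k` on the block lattice): two chart points lie in the same
`k`-block of `T^{(0)}` iff their box coordinates lie in the same `n`-block of `ℤ^{d+1}` (p33's `val_blkIter`, pv07/b04's `blk`).
[cite: BalabanImbrieJaffe1985, (5.1.2)–(5.1.3) p.313] -/
theorem blkIter_cubePt_eq_iff {k : ℕ} (hk : k ≤ P.m + P.K) (hn : n = P.L ^ k) (hfit : ∀ i, c i * n + N i ≤ P.sitesPerDir 0)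
    {z z' : Fin (d + 1) → ℤ} (hz : z ∈ boxDom N) (hz' : z' ∈ boxDom N) :
    blkIter k (cubePt hPd n c z) = blkIter k (cubePt hPd n c z') ↔ blk n z = blk n z' := by
  have hk0 : 0 + k ≤ P.m + P.K := by omega
  have hn0 : (0 : ℤ) < n := by rw [hn]; exact_mod_cast pow_pos P.L_pos k
  have key : ∀ {w : Fin (d + 1) → ℤ}, w ∈ boxDom N → ∀ μ : Fin P.d,
      (((blkIter k (cubePt hPd n c w)) μ).val : ℤ) = c (Fin.cast hPd μ) + blk n w (Fin.cast hPd μ) := by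
    intro w hw μ
    rw [val_blkIter k hk0 _ μ, Int.natCast_div, val_cubePt hPd hfit hw μ, ← hn, blk]
    push_cast
    rw [add_comm, Int.add_mul_ediv_right _ _ hn0.ne', add_comm]
  constructor
  · intro h
    funext i
    have hμ : (((blkIter k (cubePt hPd n c z)) (Fin.cast hPd.symm i)).val : ℤ) =
        (((blkIter k (cubePt hPd n c z')) (Fin.cast hPd.symm i)).val : ℤ) := by rw [h]
    rw [key hz, key hz', cast_cast] at hμ
    omega
  · intro h
    funext μ
    apply ZMod.val_injective
    have e := (key hz μ).trans ((congrArg (fun w : Fin (d + 1) → ℤ => (c (Fin.cast hPd μ) : ℤ) + w (Fin.cast hPd μ)) h).trans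
      (key hz' μ).symm)
    exact_mod_cast e

/-- **The cube is a union of `k`-blocks** when its corner sits on the block lattice (`c·L^k`) and its sides are multiples of `L^k`
(`N_i = L^k·M_i`) — the standing hypothesis of gen 15's Neumann problem. [cite: BalabanImbrieJaffe1988, (2.27) p.263] -/
theorem isBlockUnion_cubeT {k : ℕ} (hk : k ≤ P.m + P.K) (hn : n = P.L ^ k) {M : Fin (d + 1) → ℕ}
    (hfit : ∀ i, c i * n + n * M i ≤ P.sitesPerDir 0) :
    IsBlockUnion k (cubeT hPd n c (fun i => n * M i)) := by
  have hk0 : 0 + k ≤ P.m + P.K := by omega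
  have hnpos : 0 < n := by rw [hn]; exact pow_pos P.L_pos k
  intro x hx y hy
  rw [mem_cubeT_iff_val hPd hfit] at hx ⊢
  intro μ
  have hμ := hx μ
  have hb : (y μ).val / P.L ^ k = (x μ).val / P.L ^ k := by
    rw [← val_blkIter k hk0 y μ, ← val_blkIter k hk0 x μ, mem_blockK.1 hy]
  rw [← hn] at hb
  set i := Fin.cast hPd μ
  -- `c_i ≤ x_μ / n < c_i + M_i`, and `y_μ / n = x_μ / n`
  have h1 : c i ≤ (x μ).val / n := by
    rw [Nat.le_div_iff_mul_le hnpos]; exact hμ.1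
  have h2 : (x μ).val / n < c i + M i := by
    rw [Nat.div_lt_iff_lt_mul hnpos]; have := hμ.2; rw [Nat.add_mul]; linarith [Nat.mul_comm n (M i)]
  rw [← hb] at h1 h2
  constructor
  · exact (Nat.le_div_iff_mul_le hnpos).1 h1
  · have := (Nat.div_lt_iff_lt_mul hnpos).1 h2
    rw [Nat.add_mul] at this; linarith [Nat.mul_comm n (M i)]

end ChartGeometry

/-! ## §3 The Neumann operator of a cube at `u = 1` IS [6]'s zero-field box operator `boxOpR` under the chart (entry by entry) -/

section TorusSide

variable {j : ℕ}

/-- kernel: `e_μ ≠ 0` on the tori of `Setup` (every period is `≥ 2`): `x + e_μ ≠ x`. [folklore] -/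
private theorem shift_ne_self (x : Balaban1983to89.Site P j) (μ : Fin P.d) : x.shift μ ≠ x := by
  intro h
  have h1 := congrFun h μ
  simp only [Balaban1983to89.Site.shift, Function.update_self] at h1
  exact one_ne_zero (add_eq_left.1 h1)

/-- kernel: `x − e_μ ≠ x`. [folklore] -/
private theorem unshift_ne_self (x : Balaban1983to89.Site P j) (μ : Fin P.d) : x.unshift μ ≠ x := by
  intro h
  have h1 := congrArg (fun y => Balaban1983to89.Site.shift y μ) h
  simp only [B5Display136Torus.shift_unshift] at h1
  exact shift_ne_self x μ h1.symm

/-- kernel: `x = s + e_μ ↔ s = x − e_μ`. [folklore] -/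
private theorem eq_shift_iff (x s : Balaban1983to89.Site P j) (μ : Fin P.d) : x = s.shift μ ↔ s = x.unshift μ := by
  constructor
  · intro h; rw [h, B5Display136Torus.unshift_shift]
  · intro h; rw [h, B5Display136Torus.shift_unshift]

/-- kernel: the entries of the Neumann-cut derivative of a region at `u = 1` are the REAL numbers
`[b ⊂ Ω]·c([x = b₊] − [x = b₋])`. [cite: BalabanImbrieJaffe1988, (5.6.10) p.287] -/
theorem dN_flat_region_apply (c : ℝ) (Ω : Finset (Balaban1983to89.Site P j)) (b : PBond P j) (x : Balaban1983to89.Site P j) :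
    dN c (1 : GaugeField P j U1) Ω b x =
      ((if b ∈ starB Ω then c * ((if x = b.tgt then (1 : ℝ) else 0) - (if x = b.src then (1 : ℝ) else 0)) else 0 : ℝ) : ℂ) := by
  rw [dN_apply]
  by_cases hb : b ∈ starB Ω
  · rw [if_pos hb, if_pos hb]
    show (c : ℂ) * (if x = b.tgt then cfg (1 : GaugeField P j U1) b else 0) - (c : ℂ) * (if x = b.src then 1 else 0) = _
    rw [cfg_flat]
    split_ifs <;> push_cast <;> ring
  · rw [if_neg hb, if_neg hb, Complex.ofReal_zero]

/-- **The Laplacian Gram matrix of a region at `u = 1`, entrywise** — only the two bonds `⟨x, x+e_μ⟩`, `⟨x−e_μ, x⟩` through `x` in each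
direction contribute: `((χ_ΩD₁)ᴴ(χ_ΩD₁))(x,x′) = c²Σ_μ{[x, x+e_μ ∈ Ω]([x′ = x] − [x′ = x+e_μ]) + [x−e_μ, x ∈ Ω]([x′ = x] − [x′ = x−e_μ])}`
(a real number). [cite: BalabanImbrieJaffe1988, (5.6.10) p.287] -/
theorem gram_dN_flat_region_apply (c : ℝ) (Ω : Finset (Balaban1983to89.Site P j)) (x x' : Balaban1983to89.Site P j) :
    ((dN c (1 : GaugeField P j U1) Ω)ᴴ * dN c (1 : GaugeField P j U1) Ω) x x' =
      ((c ^ 2 * ∑ μ : Fin P.d,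
        ((if x ∈ Ω ∧ x.shift μ ∈ Ω then (if x' = x then (1 : ℝ) else 0) - (if x' = x.shift μ then (1 : ℝ) else 0) else 0) +
         (if x.unshift μ ∈ Ω ∧ x ∈ Ω then (if x' = x then (1 : ℝ) else 0) - (if x' = x.unshift μ then (1 : ℝ) else 0) else 0)) : ℝ) : ℂ) := by
  rw [mul_apply]
  simp_rw [conjTranspose_apply, dN_flat_region_apply, Complex.star_def, Complex.conj_ofReal, ← Complex.ofReal_mul]
  rw [← Complex.ofReal_sum]
  congr 1
  rw [sum_bond_eq, sum_comm, mul_sum]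
  refine sum_congr rfl fun μ _ => ?_
  rw [Fintype.sum_eq_add x (x.unshift μ) (unshift_ne_self x μ).symm]
  · -- the two surviving bonds
    have ht : ((⟨x, μ⟩ : PBond P j).tgt) = x.shift μ := rfl
    have ht' : ((⟨x.unshift μ, μ⟩ : PBond P j).tgt) = x := B5Display136Torus.shift_unshift x μ
    simp only [ht, ht', mem_starB, if_neg (shift_ne_self x μ).symm, if_neg (unshift_ne_self x μ).symm]
    by_cases h1 : x ∈ Ω <;> by_cases h2 : x.shift μ ∈ Ω <;> by_cases h3 : x.unshift μ ∈ Ω <;>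
      simp only [h1, h2, h3, and_true, and_false, if_true, if_false] <;> ring
  · -- every other bond misses `x`
    rintro s ⟨hs1, hs2⟩
    have hx1 : ¬ x = (⟨s, μ⟩ : PBond P j).tgt := fun h => hs2 ((eq_shift_iff x s μ).1 h)
    have hx2 : ¬ x = (⟨s, μ⟩ : PBond P j).src := fun h => hs1 h.symm
    simp only [hx1, hx2, if_false, sub_self, mul_zero, ite_self, zero_mul]

/-- kernel: the entries of `Q_k(1)|_Ω` — `L^{−kd}` when the block of `y` lies in `Ω` and contains `x`, `0` otherwise.
[cite: BalabanImbrieJaffe1985, (4.6.1) p.313] -/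
theorem qMatK_flat_region_apply {k : ℕ} (hk : j + k ≤ P.m + P.K) (Ω : Finset (Balaban1983to89.Site P j))
    (y : Balaban1983to89.Site P (j+k)) (x : Balaban1983to89.Site P j) :
    qMatK (1 : GaugeField P j U1) k Ω y x = if blockK k y ⊆ Ω ∧ blkIter k x = y then (((P.L : ℂ) ^ (k * P.d))⁻¹) else 0 := by
  rw [qMatK_apply, holCK_flat hk, mul_one]
  simp only [mem_blockK]

/-- **The block Gram matrix of a `k`-block union at `u = 1`, entrywise on `Ω`**: `((Q_k|_Ω)ᴴ(Q_k|_Ω))(x,x′) = L^{−2kd}·[x_k = x′_k]` for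
`x ∈ Ω` (a real number). [cite: BalabanImbrieJaffe1985, (4.6.1) p.313] -/
theorem gram_qMatK_flat_region_apply {k : ℕ} (hk : j + k ≤ P.m + P.K) {Ω : Finset (Balaban1983to89.Site P j)} (hΩ : IsBlockUnion k Ω)
    {x : Balaban1983to89.Site P j} (hx : x ∈ Ω) (x' : Balaban1983to89.Site P j) :
    ((qMatK (1 : GaugeField P j U1) k Ω)ᴴ * qMatK (1 : GaugeField P j U1) k Ω) x x' =
      ((if blkIter k x = blkIter k x' then ((((P.L : ℝ) ^ (k * P.d))⁻¹) ^ 2) else 0 : ℝ) : ℂ) := by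
  rw [mul_apply]
  simp_rw [conjTranspose_apply, qMatK_flat_region_apply hk]
  have hin : blockK k (blkIter k x) ⊆ Ω := hΩ x hx
  have key : ∀ y : Balaban1983to89.Site P (j+k),
      star (if blockK k y ⊆ Ω ∧ blkIter k x = y then (((P.L : ℂ) ^ (k * P.d))⁻¹) else 0) *
        (if blockK k y ⊆ Ω ∧ blkIter k x' = y then (((P.L : ℂ) ^ (k * P.d))⁻¹) else 0) =
        if blkIter k x = y then
          ((if blkIter k x = blkIter k x' then ((((P.L : ℝ) ^ (k * P.d))⁻¹) ^ 2) else 0 : ℝ) : ℂ) else 0 := by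
    intro y
    by_cases h1 : blkIter k x = y
    · rw [if_pos ⟨h1 ▸ hin, h1⟩, if_pos h1]
      by_cases h2 : blkIter k x' = y
      · rw [if_pos ⟨h1 ▸ hin, h2⟩, if_pos (h1.trans h2.symm)]
        have e : star (((P.L : ℂ) ^ (k * P.d))⁻¹) = (((P.L : ℂ) ^ (k * P.d))⁻¹) := by
          rw [Complex.star_def, map_inv₀, map_pow, Complex.conj_natCast]
        rw [e]; push_cast; ring
      · rw [if_neg (fun h => h2 h.2), if_neg (fun h => h2 (h.symm.trans h1)), mul_zero, Complex.ofReal_zero]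
    · rw [if_neg (fun h => h1 h.2), star_zero, zero_mul, if_neg h1]
  simp_rw [key]
  rw [sum_ite_eq, if_pos (mem_univ _)]

/-- **The Neumann operator of a `k`-block union at `u = 1`, entrywise on `Ω`** (rows `x ∈ Ω`). [cite: BalabanImbrieJaffe1988, (2.27) p.263] -/
theorem nOp_flat_region_apply {k : ℕ} (hk : j + k ≤ P.m + P.K) (a c : ℝ) {Ω : Finset (Balaban1983to89.Site P j)}
    (hΩ : IsBlockUnion k Ω) {x : Balaban1983to89.Site P j} (hx : x ∈ Ω) (x' : Balaban1983to89.Site P j) :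
    nOp a c (1 : GaugeField P j U1) k Ω x x' =
      ((c ^ 2 * (∑ μ : Fin P.d,
        ((if x ∈ Ω ∧ x.shift μ ∈ Ω then (if x' = x then (1 : ℝ) else 0) - (if x' = x.shift μ then (1 : ℝ) else 0) else 0) +
         (if x.unshift μ ∈ Ω ∧ x ∈ Ω then (if x' = x then (1 : ℝ) else 0) - (if x' = x.unshift μ then (1 : ℝ) else 0) else 0))) +
        a * (if blkIter k x = blkIter k x' then ((((P.L : ℝ) ^ (k * P.d))⁻¹) ^ 2) else 0) : ℝ) : ℂ) := by
  rw [nOp_eq, Matrix.add_apply, Matrix.smul_apply, gram_dN_flat_region_apply, gram_qMatK_flat_region_apply hk hΩ hx, smul_eq_mul,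
    ← Complex.ofReal_mul, ← Complex.ofReal_add]

end TorusSide

section BoxSide

/-- kernel (real version of b04's `sum_nbrs`): a sum over the nearest neighbours is the sum over the `2(d+1)` unit steps. [folklore] -/
private theorem sum_nbrs_real (φ : (Fin (d + 1) → ℤ) → ℝ) (z : Fin (d + 1) → ℤ) :
    ∑ u ∈ nbrs z, φ u = ∑ i, φ (z + Pi.single i 1) + ∑ i, φ (z - Pi.single i 1) := by
  have h := B4Green242Bridge.sum_nbrs (fun u => (φ u : ℂ)) z
  exact_mod_cast h

/-- **[6]'s box Laplacian entry as a sum over directions**: `−Δ^N_□(z,z′) = [z′ = z]·Σ_i([z+e_i ∈ □] + [z−e_i ∈ □]) − Σ_i([z′ = z+e_i] +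
[z′ = z−e_i])` for box points `z, z′`. [cite: Balaban1983RegularityDecay, p.572 (1.3), dictionary] -/
theorem neumannLapK_eq_sum (N : Fin (d + 1) → ℕ) (z z' : Fin (d + 1) → ℤ) :
    (neumannLapK N z z' : ℝ) =
      (if z' = z then (1 : ℝ) else 0) * ∑ i, ((if z + Pi.single i 1 ∈ boxDom N then (1 : ℝ) else 0) +
          (if z - Pi.single i 1 ∈ boxDom N then (1 : ℝ) else 0)) -
        ∑ i, ((if z' = z + Pi.single i 1 then (1 : ℝ) else 0) + (if z' = z - Pi.single i 1 then (1 : ℝ) else 0)) := by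
  have hcard : ((((nbrs z).filter fun w => w ∈ boxDom N).card : ℕ) : ℝ) =
      ∑ i, ((if z + Pi.single i 1 ∈ boxDom N then (1 : ℝ) else 0) + (if z - Pi.single i 1 ∈ boxDom N then (1 : ℝ) else 0)) := by
    rw [← Finset.sum_boole, sum_nbrs_real, ← Finset.sum_add_distrib]
  have hmem : (if z' ∈ nbrs z then (1 : ℝ) else 0) =
      ∑ i, ((if z' = z + Pi.single i 1 then (1 : ℝ) else 0) + (if z' = z - Pi.single i 1 then (1 : ℝ) else 0)) := by
    rw [← Finset.sum_ite_eq (nbrs z) z' (fun _ => (1 : ℝ)), sum_nbrs_real, ← Finset.sum_add_distrib]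
  unfold neumannLapK
  by_cases h : z' = z
  · subst h
    rw [if_pos rfl, if_pos rfl, one_mul, hcard, ← hmem, if_neg (not_mem_nbrs_self z'), sub_zero]
  · rw [if_neg h, if_neg h, zero_mul, zero_sub, ← hmem]
    split_ifs <;> simp

end BoxSide

section Bridge

variable (hPd : P.d = d + 1) {n : ℕ} {c : Fin (d + 1) → ℕ} {M : Fin (d + 1) → ℕ}

/-- kernel: reindex a sum over torus directions `μ` as a sum over box directions `i`. [folklore] -/
private theorem sum_dir (f : Fin (d + 1) → ℝ) : ∑ μ : Fin P.d, f (Fin.cast hPd μ) = ∑ i : Fin (d + 1), f i :=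
  Fintype.sum_equiv (finCongr hPd) _ _ fun _ => rfl

/-- kernel: for box points of a cube shorter than the torus the chart is injective: `cubePt z = cubePt z′ ↔ z = z′`.
[cite: Balaban1983RegularityDecay, p.572, dictionary] -/
theorem cubePt_eq_iff {N : Fin (d + 1) → ℕ} (hN : ∀ i, N i < P.sitesPerDir 0) {z z' : Fin (d + 1) → ℤ} (hz : z ∈ boxDom N)
    (hz' : z' ∈ boxDom N) : cubePt hPd n c z = cubePt hPd n c z' ↔ z = z' := by
  refine ⟨fun h => cubePt_inj_of_abs_lt hPd (fun i => ?_) h, fun h => by rw [h]⟩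
  have h1 := (mem_boxDom.1 hz) i; have h2 := (mem_boxDom.1 hz') i; have h3 := hN i
  rw [abs_lt]; constructor <;> omega

/-- **THE LAPLACIAN PART UNDER THE CHART**: for box points `z, z′` of a cube shorter than the torus, the direction sum of
`gram_dN_flat_region_apply` at `x = cubePt z`, `x′ = cubePt z′` IS [6]'s box Laplacian entry `−Δ^N_□(z,z′)`.
[cite: Balaban1983RegularityDecay, p.572 (1.3), dictionary] -/
theorem lapSum_cubePt {N : Fin (d + 1) → ℕ} (hN : ∀ i, N i < P.sitesPerDir 0) {z z' : Fin (d + 1) → ℤ} (hz : z ∈ boxDom N)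
    (hz' : z' ∈ boxDom N) :
    (∑ μ : Fin P.d,
      ((if cubePt hPd n c z ∈ cubeT hPd n c N ∧ (cubePt hPd n c z).shift μ ∈ cubeT hPd n c N then
          (if cubePt hPd n c z' = cubePt hPd n c z then (1 : ℝ) else 0) -
            (if cubePt hPd n c z' = (cubePt hPd n c z).shift μ then (1 : ℝ) else 0) else 0) +
       (if (cubePt hPd n c z).unshift μ ∈ cubeT hPd n c N ∧ cubePt hPd n c z ∈ cubeT hPd n c N then
          (if cubePt hPd n c z' = cubePt hPd n c z then (1 : ℝ) else 0) -
            (if cubePt hPd n c z' = (cubePt hPd n c z).unshift μ then (1 : ℝ) else 0) else 0))) =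
      (neumannLapK N z z' : ℝ) := by
  have hx : cubePt hPd n c z ∈ cubeT hPd n c N := cubePt_mem_cubeT hPd hz
  have hzz : (cubePt hPd n c z' = cubePt hPd n c z) ↔ z' = z := cubePt_eq_iff hPd hN hz' hz
  have ne_add : ∀ i : Fin (d + 1), ¬ z = z + Pi.single i 1 := fun i h => by
    have h1 := congrFun h i; simp only [Pi.add_apply, Pi.single_eq_same] at h1; omega
  have ne_sub : ∀ i : Fin (d + 1), ¬ z = z - Pi.single i 1 := fun i h => by
    have h1 := congrFun h i; simp only [Pi.sub_apply, Pi.single_eq_same] at h1; omega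
  have ne_pm : ∀ i : Fin (d + 1), ¬ z + Pi.single i (1 : ℤ) = z - Pi.single i 1 := fun i h => by
    have h1 := congrFun h i; simp only [Pi.add_apply, Pi.sub_apply, Pi.single_eq_same] at h1; omega
  rw [neumannLapK_eq_sum N z z', mul_sum, ← sum_sub_distrib, ← sum_dir hPd]
  refine sum_congr rfl fun μ _ => ?_
  simp only [shift_cubePt_mem_iff hPd hN hz, unshift_cubePt_mem_iff hPd hN hz, cubePt_eq_shift_iff hPd hN hz hz',
    cubePt_eq_unshift_iff hPd hN hz hz', hzz, hx, and_true, true_and]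
  by_cases h0 : z' = z
  · -- the diagonal: `z′ = z` is not a neighbour of `z`
    simp only [h0, ne_add, ne_sub, if_true, if_false, sub_zero, one_mul, add_zero]
  · by_cases ha : z' = z + Pi.single (Fin.cast hPd μ) 1
    · -- the forward neighbour: it lies in the box, and it is neither `z` nor the backward neighbour
      have hp : z + Pi.single (Fin.cast hPd μ) 1 ∈ boxDom N := ha ▸ hz'
      have hz0 : ¬ z + Pi.single (Fin.cast hPd μ) (1 : ℤ) = z := fun h => ne_add _ h.symm
      simp only [ha, hp, hz0, ne_pm, if_true, if_false, zero_sub, sub_zero, ite_self, add_zero, zero_mul]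
    · by_cases hb : z' = z - Pi.single (Fin.cast hPd μ) 1
      · -- the backward neighbour
        have hm : z - Pi.single (Fin.cast hPd μ) 1 ∈ boxDom N := hb ▸ hz'
        have hz0 : ¬ z - Pi.single (Fin.cast hPd μ) (1 : ℤ) = z := fun h => ne_sub _ h.symm
        have hmp : ¬ z - Pi.single (Fin.cast hPd μ) (1 : ℤ) = z + Pi.single (Fin.cast hPd μ) 1 := fun h => ne_pm _ h.symm
        simp only [hb, hm, hz0, hmp, if_true, if_false, zero_sub, sub_zero, ite_self, zero_add, zero_mul]
      · -- anything else contributes nothing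
        simp only [h0, ha, hb, if_false, sub_self, ite_self, add_zero, zero_mul]

/-- **THE OPERATOR BRIDGE ON A CUBE AT `u = 1`**: for a cube `□ = c·L^k + Π_i[0, L^kM_i)` of the fine torus that fits and is shorter than the
torus in every direction, gen 15's Neumann operator `−Δ^N_{1,□} + (α_kL^{k(d+1)})Q_k(1)|_□ᴴQ_k(1)|_□` (`c = ε⁻¹`) has, between chart points, the
entries of `(L^kε)^{−2}·boxOpR (L^k) a_k 0 M` — [6]'s zero-field box operator `n²(−Δ^N_□) + a_kn^{−(d+1)}1_{same block}` of b04/p38's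
`B4BoxCov237`/`B4Thm110ZeroBox` (`a_k = B1.aSeq a L k`, `α_k = a_k(L^kε)^{−2}`). [cite: Balaban1983RegularityDecay, p.572 (1.6), dictionary] -/
theorem nOp_cube_apply {k : ℕ} (hk : k ≤ P.m + P.K) (hn : n = P.L ^ k) (hfit : ∀ i, c i * n + n * M i ≤ P.sitesPerDir 0)
    (hN : ∀ i, n * M i < P.sitesPerDir 0) (a : ℝ) {z z' : Fin (d + 1) → ℤ} (hz : z ∈ boxDom (fun i => n * M i))
    (hz' : z' ∈ boxDom (fun i => n * M i)) :
    nOp (B1RG242Torus.α P a k * (P.L : ℝ) ^ (k * P.d)) P.eps⁻¹ (1 : GaugeField P 0 U1) k (cubeT hPd n c (fun i => n * M i))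
        (cubePt hPd n c z) (cubePt hPd n c z') =
      (((P.spacing k ^ 2)⁻¹ * boxOpR n (B1.aSeq a P.L k) 0 M ⟨z, hz⟩ ⟨z', hz'⟩ : ℝ) : ℂ) := by
  have hk0 : 0 + k ≤ P.m + P.K := by omega
  have hΩ := isBlockUnion_cubeT hPd hk hn hfit
  rw [nOp_flat_region_apply hk0 _ _ hΩ (cubePt_mem_cubeT hPd hz), lapSum_cubePt hPd hN hz hz']
  congr 1
  have hblk : (blkIter k (cubePt hPd n c z) = blkIter k (cubePt hPd n c z')) ↔ (blk n z' = blk n z) := by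
    rw [blkIter_cubePt_eq_iff hPd hk hn hfit hz hz']; exact eq_comm
  have hL0 : (P.L : ℝ) ≠ 0 := P.cast_L_pos.ne'
  have hε : P.eps ≠ 0 := P.eps_pos.ne'
  have hn' : (n : ℝ) = (P.L : ℝ) ^ k := by rw [hn]; push_cast; rfl
  simp only [boxOpR, opBoxR, Matrix.of_apply, diagK, avgK, hblk, B1RG242Torus.α, Params.spacing, hPd, hn', ite_self,
    zero_add, ← pow_mul]
  by_cases hb : blk n z' = blk n z
  · simp only [hb, if_true]
    field_simp
    ring
  · simp only [hb, if_false, mul_zero, add_zero]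
    field_simp
    ring

end Bridge

/-! ## §4 `G_k(□, 1)` IS the chart push-forward of [6]'s box Green's function `boxOpR⁻¹` (uniqueness of the inverse) -/

section CubePropagator

variable (hPd : P.d = d + 1) {n : ℕ} {c M : Fin (d + 1) → ℕ}

/-- [6]'s zero-field box Green's function `(n²(−Δ^N_□) + m² + a·n^{−(d+1)}1_{same block})⁻¹(z,z′)` (b04/p38's `(boxOpR n a m2 M)⁻¹`) read as
a kernel on all of `ℤ^{d+1} × ℤ^{d+1}`, extended by `0` off the box `Π_i[0, nM_i)`.
[cite: Balaban1983RegularityDecay, p.572 (1.6); p.584 (2.44), dictionary] -/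
def boxInvR (n : ℕ) (a m2 : ℝ) (M : Fin (d + 1) → ℕ) (z z' : Fin (d + 1) → ℤ) : ℝ :=
  if h : z ∈ boxDom (fun i => n * M i) ∧ z' ∈ boxDom (fun i => n * M i) then (boxOpR n a m2 M)⁻¹ ⟨z, h.1⟩ ⟨z', h.2⟩ else 0

/-- kernel: on the box, `boxInvR` is the inverse matrix entry. [cite: Balaban1983RegularityDecay, p.584 (2.44), dictionary] -/
theorem boxInvR_of_mem {n : ℕ} {a m2 : ℝ} {M : Fin (d + 1) → ℕ} {z z' : Fin (d + 1) → ℤ}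
    (hz : z ∈ boxDom (fun i => n * M i)) (hz' : z' ∈ boxDom (fun i => n * M i)) :
    boxInvR n a m2 M z z' = (boxOpR n a m2 M)⁻¹ ⟨z, hz⟩ ⟨z', hz'⟩ := by
  unfold boxInvR
  rw [dif_pos ⟨hz, hz'⟩]

/-- **The candidate for `G_k(□,1)`**: `s²·boxOpR⁻¹` read through the chart on `□ × □` and `0` elsewhere — a REAL matrix on `T^{(0)}`
(`s² = (L^kε)²` converts [6]'s lattice units back to the `ε`-units of the torus operator). [cite: BalabanImbrieJaffe1988, (2.27) p.263] -/
def gCubeR (hPd : P.d = d + 1) (n : ℕ) (c M : Fin (d + 1) → ℕ) (s2 a : ℝ) :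
    Matrix (Balaban1983to89.Site P 0) (Balaban1983to89.Site P 0) ℝ :=
  Matrix.of fun x y =>
    if x ∈ cubeT hPd n c (fun i => n * M i) ∧ y ∈ cubeT hPd n c (fun i => n * M i) then
      s2 * boxInvR n a 0 M (boxCoord hPd n c x) (boxCoord hPd n c y)
    else 0

/-- kernel: rows off the cube vanish. [cite: BalabanImbrieJaffe1988, (2.27) p.263] -/
theorem gCubeR_apply_of_not_mem_left (s2 a : ℝ) {x : Balaban1983to89.Site P 0} (hx : x ∉ cubeT hPd n c (fun i => n * M i))
    (y : Balaban1983to89.Site P 0) : gCubeR hPd n c M s2 a x y = 0 := by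
  simp only [gCubeR, Matrix.of_apply, hx, false_and, if_false]

/-- kernel: columns off the cube vanish. [cite: BalabanImbrieJaffe1988, (2.27) p.263] -/
theorem gCubeR_apply_of_not_mem_right (s2 a : ℝ) (x : Balaban1983to89.Site P 0) {y : Balaban1983to89.Site P 0}
    (hy : y ∉ cubeT hPd n c (fun i => n * M i)) : gCubeR hPd n c M s2 a x y = 0 := by
  simp only [gCubeR, Matrix.of_apply, hy, and_false, if_false]

/-- kernel: between chart points the candidate is `s²·boxOpR⁻¹(z,v)`. [cite: BalabanImbrieJaffe1988, (2.27) p.263] -/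
theorem gCubeR_apply_cubePt (hfit : ∀ i, c i * n + n * M i ≤ P.sitesPerDir 0) (s2 a : ℝ) {z v : Fin (d + 1) → ℤ}
    (hz : z ∈ boxDom (fun i => n * M i)) (hv : v ∈ boxDom (fun i => n * M i)) :
    gCubeR hPd n c M s2 a (cubePt hPd n c z) (cubePt hPd n c v) = s2 * (boxOpR n a 0 M)⁻¹ ⟨z, hz⟩ ⟨v, hv⟩ := by
  simp only [gCubeR, Matrix.of_apply, cubePt_mem_cubeT hPd hz, cubePt_mem_cubeT hPd hv, and_self, if_true,
    boxCoord_cubePt hPd hfit hz, boxCoord_cubePt hPd hfit hv, boxInvR_of_mem hz hv]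

/-- kernel: a sum over the cube is the sum over the box through the chart. [cite: Balaban1983RegularityDecay, p.572, dictionary] -/
theorem sum_cubeT {N : Fin (d + 1) → ℕ} (hfit : ∀ i, c i * n + N i ≤ P.sitesPerDir 0) {β : Type*} [AddCommMonoid β]
    (g : Balaban1983to89.Site P 0 → β) : ∑ w ∈ cubeT hPd n c N, g w = ∑ v ∈ boxDom N, g (cubePt hPd n c v) := by
  rw [cubeT, Finset.sum_image (cubePt_injOn hPd hfit)]

/-- kernel: **the candidate applied to a vector, at a cube point** — `(G φ)(c·n + z) = s²·(boxOpR⁻¹φ^□)(z)` with `φ^□(v) = φ(c·n + v)` the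
source read in the box. [cite: BalabanImbrieJaffe1988, (2.27) p.263] -/
theorem gCubeR_mulVec_cubePt (hfit : ∀ i, c i * n + n * M i ≤ P.sitesPerDir 0) (s2 a : ℝ) (φ : Balaban1983to89.Site P 0 → ℝ)
    {z : Fin (d + 1) → ℤ} (hz : z ∈ boxDom (fun i => n * M i)) :
    (gCubeR hPd n c M s2 a *ᵥ φ) (cubePt hPd n c z) =
      s2 * ((boxOpR n a 0 M)⁻¹ *ᵥ fun v => φ (cubePt hPd n c (v : Fin (d + 1) → ℤ))) ⟨z, hz⟩ := by
  simp only [mulVec, dotProduct]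
  rw [← Finset.sum_subset (Finset.subset_univ (cubeT hPd n c fun i => n * M i))
      (fun w _ hw => by rw [gCubeR_apply_of_not_mem_right hPd _ _ _ hw, zero_mul]),
    sum_cubeT hPd hfit, ← Finset.sum_coe_sort, Finset.mul_sum]
  refine Finset.sum_congr rfl fun v _ => ?_
  rw [gCubeR_apply_cubePt hPd hfit _ _ hz v.2, mul_assoc]

/-- kernel: **off the cube the candidate applied to a vector vanishes**. [cite: BalabanImbrieJaffe1988, (2.27) p.263] -/
theorem gCubeR_mulVec_of_not_mem (s2 a : ℝ) (φ : Balaban1983to89.Site P 0 → ℝ) {x : Balaban1983to89.Site P 0}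
    (hx : x ∉ cubeT hPd n c (fun i => n * M i)) : (gCubeR hPd n c M s2 a *ᵥ φ) x = 0 := by
  simp only [mulVec, dotProduct, gCubeR_apply_of_not_mem_left hPd _ _ hx, zero_mul, sum_const_zero]

/-- kernel: the columns of the Neumann operator of `Ω` off `Ω` vanish (`nOp·1_Ω = nOp`). [cite: BalabanImbrieJaffe1988, (2.27) p.263] -/
theorem nOp_apply_of_not_mem_right {j : ℕ} (a' c' : ℝ) (U : GaugeField P j U1) (k : ℕ) {Ω : Finset (Balaban1983to89.Site P j)}
    (w : Balaban1983to89.Site P j) {y : Balaban1983to89.Site P j} (hy : y ∉ Ω) : nOp a' c' U k Ω w y = 0 := by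
  have h := congrFun (congrFun (nOp_mul_proj a' c' U k Ω) w) y
  rw [proj, Matrix.mul_diagonal, if_neg hy, mul_zero] at h
  exact h.symm

/-- kernel: `G·1_□ = G` for the candidate. [cite: BalabanImbrieJaffe1988, (2.27) p.263] -/
theorem gCubeR_mul_proj (s2 a : ℝ) :
    (gCubeR hPd n c M s2 a).map Complex.ofRealHom * proj (cubeT hPd n c fun i => n * M i) =
      (gCubeR hPd n c M s2 a).map Complex.ofRealHom := by
  ext x y
  rw [proj, Matrix.mul_diagonal]
  by_cases hy : y ∈ cubeT hPd n c fun i => n * M i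
  · rw [if_pos hy, mul_one]
  · rw [if_neg hy, mul_zero, Matrix.map_apply, gCubeR_apply_of_not_mem_right hPd _ _ _ hy, map_zero]

/-- **`G·(−Δ^N_{1,□} + α_kL^{k(d+1)}Q_k(1)|_□ᴴQ_k(1)|_□) = 1_□` FOR THE CANDIDATE** — by the entry bridge `nOp_cube_apply` the product, read
in the box, is `boxOpR⁻¹·boxOpR = 1`. [cite: Balaban1983RegularityDecay, p.572 (1.6), dictionary] -/
theorem gCubeR_mul_nOp {k : ℕ} (hk1 : 1 ≤ k) (hk : k ≤ P.m + P.K) (hn : n = P.L ^ k)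
    (hfit : ∀ i, c i * n + n * M i ≤ P.sitesPerDir 0) (hN : ∀ i, n * M i < P.sitesPerDir 0) (hM : ∀ i, 1 ≤ M i)
    {a : ℝ} (ha : 0 < a) :
    (gCubeR hPd n c M (P.spacing k ^ 2) (B1.aSeq a P.L k)).map Complex.ofRealHom *
        nOp (B1RG242Torus.α P a k * (P.L : ℝ) ^ (k * P.d)) P.eps⁻¹ (1 : GaugeField P 0 U1) k (cubeT hPd n c fun i => n * M i) =
      proj (cubeT hPd n c fun i => n * M i) := by
  have hn1 : 1 ≤ n := by rw [hn]; exact Nat.one_le_pow _ _ P.L_pos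
  have hak : 0 < B1.aSeq a P.L k := B1.aSeq_pos ha (B1RG242Torus.one_lt_cast_L P) hk1
  have hs : P.spacing k ^ 2 ≠ 0 := (pow_pos (P.spacing_pos k) 2).ne'
  ext x y
  rw [mul_apply]
  by_cases hx : x ∈ cubeT hPd n c fun i => n * M i
  · obtain ⟨z, hz, rfl⟩ := (mem_cubeT hPd).1 hx
    by_cases hy : y ∈ cubeT hPd n c fun i => n * M i
    · obtain ⟨z', hz', rfl⟩ := (mem_cubeT hPd).1 hy
      -- restrict the sum to the cube, pull it back to the box, and read it as `(boxOpR⁻¹·boxOpR)(z,z′)`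
      rw [← Finset.sum_subset (Finset.subset_univ (cubeT hPd n c fun i => n * M i))
          (fun w _ hw => by rw [Matrix.map_apply, gCubeR_apply_of_not_mem_right hPd _ _ _ hw, map_zero, zero_mul]),
        sum_cubeT hPd hfit, ← Finset.sum_coe_sort]
      have hterm : ∀ v : ↥(boxDom fun i => n * M i),
          (gCubeR hPd n c M (P.spacing k ^ 2) (B1.aSeq a P.L k)).map Complex.ofRealHom (cubePt hPd n c z)
                (cubePt hPd n c (v : Fin (d + 1) → ℤ)) *
              nOp (B1RG242Torus.α P a k * (P.L : ℝ) ^ (k * P.d)) P.eps⁻¹ (1 : GaugeField P 0 U1) k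
                (cubeT hPd n c fun i => n * M i) (cubePt hPd n c (v : Fin (d + 1) → ℤ)) (cubePt hPd n c z') =
            (((boxOpR n (B1.aSeq a P.L k) 0 M)⁻¹ ⟨z, hz⟩ v * boxOpR n (B1.aSeq a P.L k) 0 M v ⟨z', hz'⟩ : ℝ) : ℂ) := by
        intro v
        rw [Matrix.map_apply, Complex.ofRealHom_eq_coe, gCubeR_apply_cubePt hPd hfit _ _ hz v.2,
          nOp_cube_apply hPd hk hn hfit hN a v.2 hz', ← Complex.ofReal_mul]
        congr 1
        rw [mul_mul_mul_comm, mul_inv_cancel₀ hs, one_mul]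
      simp_rw [hterm]
      rw [← Complex.ofReal_sum, ← mul_apply, boxOpR_inv_mul hn1 hak le_rfl hM, proj, diagonal_apply,
        if_pos (cubePt_mem_cubeT hPd hz), Matrix.one_apply]
      by_cases hzz : z = z'
      · subst hzz
        rw [if_pos rfl, if_pos rfl, Complex.ofReal_one]
      · rw [if_neg (fun h => hzz (congrArg Subtype.val h)), if_neg (fun h => hzz ((cubePt_eq_iff hPd hN hz hz').1 h)),
          Complex.ofReal_zero]
    · -- columns off the cube: both sides vanish
      have h0 : ∀ w, nOp (B1RG242Torus.α P a k * (P.L : ℝ) ^ (k * P.d)) P.eps⁻¹ (1 : GaugeField P 0 U1) k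
          (cubeT hPd n c fun i => n * M i) w y = 0 := fun w => nOp_apply_of_not_mem_right _ _ _ _ w hy
      simp only [h0, mul_zero, sum_const_zero]
      have hne : cubePt hPd n c z ≠ y := fun h => hy (h ▸ cubePt_mem_cubeT hPd hz)
      rw [proj, diagonal_apply, if_neg hne]
  · -- rows off the cube: both sides vanish
    have h0 : ∀ w, (gCubeR hPd n c M (P.spacing k ^ 2) (B1.aSeq a P.L k)).map Complex.ofRealHom x w = 0 := fun w => by
      rw [Matrix.map_apply, gCubeR_apply_of_not_mem_left hPd _ _ hx, map_zero]
    simp only [h0, zero_mul, sum_const_zero]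
    rw [proj, diagonal_apply]
    by_cases hxy : x = y
    · rw [if_pos hxy, if_neg hx]
    · rw [if_neg hxy]

/-- **`G_k(□, 1) = s²·boxOpR⁻¹` THROUGH THE CHART**: for a cube `□ = c·L^k + Π_i[0, L^kM_i)` of the fine torus that fits and is shorter than the
torus in every direction, gen 15's Neumann propagator `gBox (α_kL^{k(d+1)}) ε⁻¹ 1 k □` ([BIJ88] (2.27) `G_k(□_α,u)` at `u = 1`) IS [6]'s zero-field
box Green's function of b04/p38 (`(boxOpR (L^k) a_k 0 M)⁻¹`, `a_k = B1.aSeq a L k`), times `(L^kε)²`, placed on `□ × □` and `0` elsewhere — by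
the uniqueness of the inverse on `ℓ²(□)` (gen 15 `eq_gBox_of_left_inverse`). [cite: BalabanImbrieJaffe1988, (2.27) p.263] -/
theorem gBox_cube_eq {k : ℕ} (hk1 : 1 ≤ k) (hk : k ≤ P.m + P.K) (hn : n = P.L ^ k)
    (hfit : ∀ i, c i * n + n * M i ≤ P.sitesPerDir 0) (hN : ∀ i, n * M i < P.sitesPerDir 0) (hM : ∀ i, 1 ≤ M i)
    {a : ℝ} (ha : 0 < a) :
    gBox (B1RG242Torus.α P a k * (P.L : ℝ) ^ (k * P.d)) P.eps⁻¹ (1 : GaugeField P 0 U1) k (cubeT hPd n c fun i => n * M i) =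
      (gCubeR hPd n c M (P.spacing k ^ 2) (B1.aSeq a P.L k)).map Complex.ofRealHom := by
  have hk0 : 0 + k ≤ P.m + P.K := by omega
  have hα : 0 < B1RG242Torus.α P a k :=
    mul_pos (B1.aSeq_pos ha (B1RG242Torus.one_lt_cast_L P) hk1) (inv_pos.mpr (pow_pos (P.spacing_pos k) 2))
  have ha' : 0 < B1RG242Torus.α P a k * (P.L : ℝ) ^ (k * P.d) := mul_pos hα (pow_pos P.cast_L_pos _)
  have hN' := isUnit_nPad hk0 (inv_ne_zero P.eps_pos.ne') ha' (1 : GaugeField P 0 U1) (isBlockUnion_cubeT hPd hk hn hfit)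
  exact (eq_gBox_of_left_inverse hN' (gCubeR_mul_nOp hPd hk1 hk hn hfit hN hM ha) (gCubeR_mul_proj hPd _ _)).symm

/-- **The entries of `G_k(□,1)` between chart points**: `G_k(□,1; c·n+z, c·n+z′) = (L^kε)²·(boxOpR (L^k) a_k 0 M)⁻¹(z,z′)` (a real number).
[cite: BalabanImbrieJaffe1988, (2.27) p.263] -/
theorem gBox_cube_apply_cubePt {k : ℕ} (hk1 : 1 ≤ k) (hk : k ≤ P.m + P.K) (hn : n = P.L ^ k)
    (hfit : ∀ i, c i * n + n * M i ≤ P.sitesPerDir 0) (hN : ∀ i, n * M i < P.sitesPerDir 0) (hM : ∀ i, 1 ≤ M i)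
    {a : ℝ} (ha : 0 < a) {z z' : Fin (d + 1) → ℤ} (hz : z ∈ boxDom (fun i => n * M i)) (hz' : z' ∈ boxDom (fun i => n * M i)) :
    gBox (B1RG242Torus.α P a k * (P.L : ℝ) ^ (k * P.d)) P.eps⁻¹ (1 : GaugeField P 0 U1) k (cubeT hPd n c fun i => n * M i)
        (cubePt hPd n c z) (cubePt hPd n c z') =
      ((P.spacing k ^ 2 * (boxOpR n (B1.aSeq a P.L k) 0 M)⁻¹ ⟨z, hz⟩ ⟨z', hz'⟩ : ℝ) : ℂ) := by
  rw [gBox_cube_eq hPd hk1 hk hn hfit hN hM ha, Matrix.map_apply, Complex.ofRealHom_eq_coe, gCubeR_apply_cubePt hPd hfit _ _ hz hz']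

/-- **`G_k(□, 1^h) = M_h·G_k(□, 1)·M_hᴴ`** at every pure-gauge background (gen 15 `gBox_gaugeAct`). [cite: BalabanImbrieJaffe1985, (6.3.2) p.320] -/
theorem gBox_cube_pureGauge {k : ℕ} (hk1 : 1 ≤ k) (hk : k ≤ P.m + P.K) (hn : n = P.L ^ k)
    (hfit : ∀ i, c i * n + n * M i ≤ P.sitesPerDir 0) (hN : ∀ i, n * M i < P.sitesPerDir 0) (hM : ∀ i, 1 ≤ M i)
    {a : ℝ} (ha : 0 < a) (h : GaugeTransf P 0 U1) :
    gBox (B1RG242Torus.α P a k * (P.L : ℝ) ^ (k * P.d)) P.eps⁻¹ (gaugeAct h (1 : GaugeField P 0 U1)) k (cubeT hPd n c fun i => n * M i) =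
      mulOp h * (gCubeR hPd n c M (P.spacing k ^ 2) (B1.aSeq a P.L k)).map Complex.ofRealHom * (mulOp h)ᴴ := by
  have hk0 : 0 + k ≤ P.m + P.K := by omega
  have hα : 0 < B1RG242Torus.α P a k :=
    mul_pos (B1.aSeq_pos ha (B1RG242Torus.one_lt_cast_L P) hk1) (inv_pos.mpr (pow_pos (P.spacing_pos k) 2))
  have ha' : 0 < B1RG242Torus.α P a k * (P.L : ℝ) ^ (k * P.d) := mul_pos hα (pow_pos P.cast_L_pos _)
  rw [gBox_gaugeAct hk0 (inv_ne_zero P.eps_pos.ne') ha' h 1 (isBlockUnion_cubeT hPd hk hn hfit),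
    gBox_cube_eq hPd hk1 hk hn hfit hN hM ha]

end CubePropagator

/-! ## §5 [6]'s Theorem (1.10), value member, for the cube propagators `G_k(□, 1^h)` — hypothesis-free, constants from `(d, ℓ, a)` -/

section Decay

variable (hPd : P.d = d + 1) {n : ℕ} {c : Fin (d + 1) → ℕ}

/-- kernel: the torus sup-distance between two points of a cube is at most their box sup-distance (`dist(·, Nℤ) ≤ |·|` coordinatewise) —
[6] p. 572 *"subsets of a torus T_η which we identify with a rectangular parallelepiped in ηZ^d"*: distances measured in the parallelepiped
dominate the printed torus distances. [cite: Balaban1983RegularityDecay, p.572, dictionary] -/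
theorem T_cubePt_le {N : Fin (d + 1) → ℕ} (hfit : ∀ i, c i * n + N i ≤ P.sitesPerDir 0) {z v : Fin (d + 1) → ℤ}
    (hz : z ∈ boxDom N) (hv : v ∈ boxDom N) : B5Ineq137Torus.T P 0 (cubePt hPd n c z) (cubePt hPd n c v) ≤ supNorm (z - v) := by
  unfold B5Ineq137Torus.T B4Sect5Torus.tdist
  have hne : (Finset.univ : Finset (Fin P.d)).Nonempty := ⟨Fin.cast hPd.symm 0, Finset.mem_univ _⟩
  obtain ⟨μ, -, hμ⟩ := Finset.exists_mem_eq_sup _ hne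
    (B4Sect5Torus.ccoord (B5Ineq137Torus.Nv P 0) (B5Ineq137Torus.toT (cubePt hPd n c z)) (B5Ineq137Torus.toT (cubePt hPd n c v)))
  rw [hμ]
  have h1 := B4Sect5Torus.ccoord_cast (B5Ineq137Torus.Nv_pos P 0) (B5Ineq137Torus.toT (cubePt hPd n c z))
    (B5Ineq137Torus.toT (cubePt hPd n c v)) μ
  have h2 : B4TorusKernel.MultiPeriod.circAbs (B5Ineq137Torus.Nv P 0 μ)
      ((((B5Ineq137Torus.toT (cubePt hPd n c z)) μ).val : ℤ) - (((B5Ineq137Torus.toT (cubePt hPd n c v)) μ).val : ℤ)) ≤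
        |(z - v) (Fin.cast hPd μ)| := by
    refine (B4TorusKernel.MultiPeriod.circAbs_le_abs (B5Ineq137Torus.Nv_pos P 0 μ) _).trans_eq ?_
    show |(((cubePt hPd n c z) μ).val : ℤ) - (((cubePt hPd n c v) μ).val : ℤ)| = _
    rw [val_cubePt hPd hfit hz, val_cubePt hPd hfit hv, Pi.sub_apply]
    congr 1
    ring
  have key : ((B4Sect5Torus.ccoord (B5Ineq137Torus.Nv P 0) (B5Ineq137Torus.toT (cubePt hPd n c z))
      (B5Ineq137Torus.toT (cubePt hPd n c v)) μ : ℕ) : ℝ) ≤ ((|(z - v) (Fin.cast hPd μ)| : ℤ) : ℝ) := by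
    have h3 := h1 ▸ h2
    exact_mod_cast h3
  exact key.trans (abs_le_supNorm _ _)

/-- kernel: the real part of a real matrix applied to a complex vector is the matrix applied to the real part. [folklore] -/
private theorem re_map_mulVec {m q : Type*} [Fintype q] (G : Matrix m q ℝ) (g : q → ℂ) (x : m) :
    ((G.map Complex.ofRealHom *ᵥ g) x).re = (G *ᵥ fun y => (g y).re) x := by
  simp only [mulVec, dotProduct, map_apply, Complex.ofRealHom_eq_coe, Complex.re_sum, Complex.re_ofReal_mul]

/-- kernel: the same for the imaginary part. [folklore] -/
private theorem im_map_mulVec {m q : Type*} [Fintype q] (G : Matrix m q ℝ) (g : q → ℂ) (x : m) :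
    ((G.map Complex.ofRealHom *ᵥ g) x).im = (G *ᵥ fun y => (g y).im) x := by
  simp only [mulVec, dotProduct, map_apply, Complex.ofRealHom_eq_coe, Complex.im_sum, Complex.im_ofReal_mul]

/-- kernel: `‖(G g)(x)‖ ≤ |(G Re g)(x)| + |(G Im g)(x)|` for a real matrix `G`. [folklore] -/
private theorem norm_map_mulVec_le {m q : Type*} [Fintype q] (G : Matrix m q ℝ) (g : q → ℂ) (x : m) :
    ‖(G.map Complex.ofRealHom *ᵥ g) x‖ ≤ |(G *ᵥ fun y => (g y).re) x| + |(G *ᵥ fun y => (g y).im) x| := by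
  rw [← re_map_mulVec, ← im_map_mulVec]
  exact Complex.norm_le_abs_re_add_abs_im _

/-- **[6] (1.10), VALUE MEMBER, FOR THE CUBE PROPAGATORS OF RECORD AT EVERY PURE-GAUGE BACKGROUND** (*"|(G_k(Ω, A)f)(x)| ≤
c₀exp(−δ₀ dist(x, supp f))‖f‖_∞ (1.10) … for rectangular parallelepipeds, the inequalities hold without any restrictions on the points"*,
p. 573; C2 (2.27)/(2.30) `G_k(□_α,u)`; [I] p. 326 *"by change of gauge u_k can be transformed … into exp[ie_kηA]"*, here `A = 0`): there are
`δ₀, c₀ > 0` depending on `(d, ℓ, a)` only (`L = ℓ + 1`) such that on EVERY torus of the series with `d + 1` directions and this `L`, for every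
level `1 ≤ k ≤ K`, every cube `□ = c·L^k + Π_i[0, L^kM_i)` (`M_i ≥ 1`) that fits (`c_iL^k + L^kM_i ≤ |T|`) and is shorter than the torus
(`L^kM_i < |T|`), every gauge function `h`, every site `x` and every complex source `f` with `‖f‖_∞ ≤ F` supported at sup-torus distance `≥ D ≥ 0`
(lattice units) from `x`: `‖(G_k(□,1^h)f)(x)‖ ≤ c₀e^{−δ₀εD}F`, `G_k(□,1^h) = gBox (α_kL^{k(d+1)}) ε⁻¹ (1^h) k □` — from p38's zero-field BOX
theorem `B4Thm110ZeroBox.thm110_zero_box_value` (window `a₋ = a₊ = a`, `m² = 0`) on the real and imaginary parts of `h̄f` read in the box,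
through `gBox_cube_pureGauge` (the torus distance is dominated by the box distance, `T_cubePt_le`, and `(L^kε)² ≤ 1`, `e^{−δ₀D/L^k} ≤ e^{−δ₀εD}`).
[cite: Balaban1983RegularityDecay, (1.10) p.573] -/
theorem decay110_flat_cube (d ℓ : ℕ) (hℓ : 1 ≤ ℓ) {a : ℝ} (ha : 0 < a) :
    ∃ δ₀ c₀ : ℝ, 0 < δ₀ ∧ 0 < c₀ ∧ ∀ (P : Params) (hPd : P.d = d + 1), P.L = ℓ + 1 →
      ∀ k : ℕ, 1 ≤ k → k ≤ P.K → ∀ (c M : Fin (d + 1) → ℕ), (∀ i, 1 ≤ M i) →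
        (∀ i, c i * P.L ^ k + P.L ^ k * M i ≤ P.sitesPerDir 0) → (∀ i, P.L ^ k * M i < P.sitesPerDir 0) →
        ∀ (h : GaugeTransf P 0 U1) (x : Balaban1983to89.Site P 0) (f : Balaban1983to89.Site P 0 → ℂ) (F D : ℝ),
          (∀ y, ‖f y‖ ≤ F) → 0 ≤ D → (∀ y, f y ≠ 0 → D ≤ B5Ineq137Torus.T P 0 x y) →
          ‖(gBox (B1RG242Torus.α P a k * (P.L : ℝ) ^ (k * P.d)) P.eps⁻¹ (gaugeAct h (1 : GaugeField P 0 U1)) k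
              (cubeT hPd (P.L ^ k) c fun i => P.L ^ k * M i) *ᵥ f) x‖ ≤ c₀ * Real.exp (-(δ₀ * (P.eps * D))) * F := by
  obtain ⟨δ₀, c₀, hδ₀, hc₀, H⟩ := B4Thm110ZeroBox.thm110_zero_box_value d ℓ hℓ a a 0 ha
  refine ⟨δ₀, 2 * c₀, hδ₀, by positivity, ?_⟩
  intro P hPd hPL k hk1 hkK c M hM hfit hN h x f F D hF hD hsupp
  have hk : k ≤ P.m + P.K := hkK.trans (Nat.le_add_left _ _)
  have e1 : P.L ^ k = (ℓ + 1) ^ k := by rw [hPL]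
  rw [e1] at hfit hN ⊢
  have hn : (ℓ + 1) ^ k = P.L ^ k := e1.symm
  have hF0 : 0 ≤ F := (norm_nonneg _).trans (hF x)
  have hncast : (((ℓ + 1) ^ k : ℕ) : ℝ) = (P.L : ℝ) ^ k := by rw [hn]; push_cast; rfl
  have hnpos : (0 : ℝ) < (((ℓ + 1) ^ k : ℕ) : ℝ) := by positivity
  -- the exponent: `L^kε ≤ 1`, so `εD ≤ D/L^k`
  have hs1 : P.spacing k ≤ 1 := by rw [← P.spacing_K]; exact B4Ineq116Torus.spacing_le_spacing P hkK
  have hs2 : P.spacing k ^ 2 ≤ 1 := pow_le_one₀ (P.spacing_pos k).le hs1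
  have hexp : Real.exp (-(δ₀ * D / (((ℓ + 1) ^ k : ℕ) : ℝ))) ≤ Real.exp (-(δ₀ * (P.eps * D))) := by
    rw [Real.exp_le_exp, neg_le_neg_iff, mul_div_assoc]
    refine mul_le_mul_of_nonneg_left ?_ hδ₀.le
    rw [le_div_iff₀ hnpos, hncast]
    calc P.eps * D * (P.L : ℝ) ^ k = P.spacing k * D := by rw [Params.spacing]; ring
      _ ≤ 1 * D := mul_le_mul_of_nonneg_right hs1 hD
      _ = D := one_mul D
  -- [6]'s box theorem, read with `L = ℓ + 1`
  have hLcast : ((ℓ : ℝ) + 1) = (P.L : ℝ) := by rw [hPL]; push_cast; ring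
  have H' := H k hk1 a 0 le_rfl le_rfl le_rfl le_rfl M hM
  rw [hLcast] at H'
  -- the real estimate for a real source `φ` supported like `f`
  have key : ∀ φ : Balaban1983to89.Site P 0 → ℝ, (∀ y, |φ y| ≤ F) → (∀ y, φ y ≠ 0 → D ≤ B5Ineq137Torus.T P 0 x y) →
      |(gCubeR hPd ((ℓ + 1) ^ k) c M (P.spacing k ^ 2) (B1.aSeq a P.L k) *ᵥ φ) x| ≤ c₀ * Real.exp (-(δ₀ * (P.eps * D))) * F := by
    intro φ hφ hφs
    by_cases hx : x ∈ cubeT hPd ((ℓ + 1) ^ k) c fun i => (ℓ + 1) ^ k * M i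
    · obtain ⟨z, hz, rfl⟩ := (mem_cubeT hPd).1 hx
      rw [gCubeR_mulVec_cubePt hPd hfit _ _ φ hz, abs_mul, abs_of_nonneg (sq_nonneg _)]
      have hB := H' (fun v => φ (cubePt hPd ((ℓ + 1) ^ k) c (v : Fin (d + 1) → ℤ))) F D (fun v => hφ _) ⟨z, hz⟩
        (fun v hv => (hφs _ hv).trans (T_cubePt_le hPd hfit hz v.2))
      calc P.spacing k ^ 2 * |(((boxOpR ((ℓ + 1) ^ k) (B1.aSeq a P.L k) 0 M)⁻¹) *ᵥ
              fun v => φ (cubePt hPd ((ℓ + 1) ^ k) c (v : Fin (d + 1) → ℤ))) ⟨z, hz⟩|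
          ≤ 1 * (c₀ * Real.exp (-(δ₀ * D / (((ℓ + 1) ^ k : ℕ) : ℝ))) * F) :=
            mul_le_mul hs2 hB (abs_nonneg _) zero_le_one
        _ ≤ c₀ * Real.exp (-(δ₀ * (P.eps * D))) * F := by
            rw [one_mul]
            exact mul_le_mul_of_nonneg_right (mul_le_mul_of_nonneg_left hexp hc₀.le) hF0
    · rw [gCubeR_mulVec_of_not_mem hPd _ _ φ hx, abs_zero]
      positivity
  -- pure gauge and the bridge: `(G(1^h)f)(x) = h(x)·(G(1)(h̄f))(x)`; split `h̄f` into real and imaginary parts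
  rw [gBox_cube_pureGauge hPd hk1 hk hn hfit hN hM ha h, ← mulVec_mulVec, ← mulVec_mulVec, mulOp_conjTranspose_mulVec, mulOp_mulVec,
    norm_mul, norm_toC, one_mul]
  set g : Balaban1983to89.Site P 0 → ℂ := fun y => (starRingEnd ℂ) (toC (h y)) * f y with hg
  have hgR : ∀ y, |(g y).re| ≤ F := fun y => ((Complex.abs_re_le_norm _).trans_eq (norm_rot h f y)).trans (hF y)
  have hgI : ∀ y, |(g y).im| ≤ F := fun y => ((Complex.abs_im_le_norm _).trans_eq (norm_rot h f y)).trans (hF y)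
  have hsR : ∀ y, (g y).re ≠ 0 → D ≤ B5Ineq137Torus.T P 0 x y := fun y hy =>
    hsupp y fun hf => hy (by simp only [hg, hf, mul_zero, Complex.zero_re])
  have hsI : ∀ y, (g y).im ≠ 0 → D ≤ B5Ineq137Torus.T P 0 x y := fun y hy =>
    hsupp y fun hf => hy (by simp only [hg, hf, mul_zero, Complex.zero_im])
  have hE2 : 2 * c₀ * Real.exp (-(δ₀ * (P.eps * D))) * F =
      c₀ * Real.exp (-(δ₀ * (P.eps * D))) * F + c₀ * Real.exp (-(δ₀ * (P.eps * D))) * F := by ring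
  rw [hE2]
  exact (norm_map_mulVec_le _ g x).trans (add_le_add (key _ hgR hsR) (key _ hgI hsI))

/-- **(1.10) FOR CUBES, KERNEL FORM**: `‖G_k(□, 1^h; x, y)‖ ≤ c₀e^{−δ₀ε|x−y|_T}` for all sites `x, y`. [cite: Balaban1983RegularityDecay, (1.10) p.573] -/
theorem decay110_flat_cube_kernel (d ℓ : ℕ) (hℓ : 1 ≤ ℓ) {a : ℝ} (ha : 0 < a) :
    ∃ δ₀ c₀ : ℝ, 0 < δ₀ ∧ 0 < c₀ ∧ ∀ (P : Params) (hPd : P.d = d + 1), P.L = ℓ + 1 →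
      ∀ k : ℕ, 1 ≤ k → k ≤ P.K → ∀ (c M : Fin (d + 1) → ℕ), (∀ i, 1 ≤ M i) →
        (∀ i, c i * P.L ^ k + P.L ^ k * M i ≤ P.sitesPerDir 0) → (∀ i, P.L ^ k * M i < P.sitesPerDir 0) →
        ∀ (h : GaugeTransf P 0 U1) (x y : Balaban1983to89.Site P 0),
          ‖gBox (B1RG242Torus.α P a k * (P.L : ℝ) ^ (k * P.d)) P.eps⁻¹ (gaugeAct h (1 : GaugeField P 0 U1)) k
              (cubeT hPd (P.L ^ k) c fun i => P.L ^ k * M i) x y‖ ≤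
            c₀ * Real.exp (-(δ₀ * (P.eps * B5Ineq137Torus.T P 0 x y))) := by
  obtain ⟨δ₀, c₀, hδ₀, hc₀, H⟩ := decay110_flat_cube d ℓ hℓ ha
  refine ⟨δ₀, c₀, hδ₀, hc₀, ?_⟩
  intro P hPd hPL k hk1 hkK c M hM hfit hN h x y
  have h1 := H P hPd hPL k hk1 hkK c M hM hfit hN h x (Pi.single y 1) 1 (B5Ineq137Torus.T P 0 x y)
    (fun z => by by_cases hz : z = y <;> simp [hz]) (B5Ineq137Torus.T_nonneg P 0 x y)
    (fun z hz => by
      by_cases hzy : z = y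
      · rw [hzy]
      · exact absurd (by simp [hzy]) hz)
  rwa [mulVec_single_one, col_apply, mul_one] at h1

end Decay

/-! ## §6 [6]'s Theorem (1.10), covariant-derivative member, for `G_k(□, 1^h)` on the bonds of the cube -/

section Deriv

variable (hPd : P.d = d + 1) {n : ℕ} {c M : Fin (d + 1) → ℕ}

/-- **`(G_k(□,1^h)f)(x) = h(x)·(G_k(□,1)(h̄f))(x)`**. [cite: BalabanImbrieJaffe1985, (6.3.2) p.320] -/
theorem gBox_cube_pureGauge_mulVec {k : ℕ} (hk1 : 1 ≤ k) (hk : k ≤ P.m + P.K) (hn : n = P.L ^ k)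
    (hfit : ∀ i, c i * n + n * M i ≤ P.sitesPerDir 0) (hN : ∀ i, n * M i < P.sitesPerDir 0) (hM : ∀ i, 1 ≤ M i)
    {a : ℝ} (ha : 0 < a) (h : GaugeTransf P 0 U1) (f : Balaban1983to89.Site P 0 → ℂ) (x : Balaban1983to89.Site P 0) :
    (gBox (B1RG242Torus.α P a k * (P.L : ℝ) ^ (k * P.d)) P.eps⁻¹ (gaugeAct h (1 : GaugeField P 0 U1)) k
        (cubeT hPd n c fun i => n * M i) *ᵥ f) x =
      toC (h x) * ((gCubeR hPd n c M (P.spacing k ^ 2) (B1.aSeq a P.L k)).map Complex.ofRealHom *ᵥ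
        fun y => (starRingEnd ℂ) (toC (h y)) * f y) x := by
  rw [gBox_cube_pureGauge hPd hk1 hk hn hfit hN hM ha h, ← mulVec_mulVec, ← mulVec_mulVec, mulOp_conjTranspose_mulVec, mulOp_mulVec]

/-- **The covariant derivative of `G_k(□,1^h)f` at the pure-gauge background**: with `u = 1^h` and `ψ = G_k(□,1)(h̄f)`,
`ε⁻¹(u_b(G f)(b₊) − (G f)(b₋)) = h(b₋)·ε⁻¹(ψ(b₊) − ψ(b₋))`. [cite: BalabanImbrieJaffe1985, (6.3.2) p.320] -/
theorem covD_gBox_cube_pureGauge {k : ℕ} (hk1 : 1 ≤ k) (hk : k ≤ P.m + P.K) (hn : n = P.L ^ k)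
    (hfit : ∀ i, c i * n + n * M i ≤ P.sitesPerDir 0) (hN : ∀ i, n * M i < P.sitesPerDir 0) (hM : ∀ i, 1 ≤ M i)
    {a : ℝ} (ha : 0 < a) (h : GaugeTransf P 0 U1) (f : Balaban1983to89.Site P 0 → ℂ) (b : PBond P 0) :
    covD P.eps⁻¹ (cfg (gaugeAct h (1 : GaugeField P 0 U1)))
        (gBox (B1RG242Torus.α P a k * (P.L : ℝ) ^ (k * P.d)) P.eps⁻¹ (gaugeAct h (1 : GaugeField P 0 U1)) k
          (cubeT hPd n c fun i => n * M i) *ᵥ f) b =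
      toC (h b.src) * (((P.eps⁻¹ : ℝ) : ℂ) *
        (((gCubeR hPd n c M (P.spacing k ^ 2) (B1.aSeq a P.L k)).map Complex.ofRealHom *ᵥ
            fun y => (starRingEnd ℂ) (toC (h y)) * f y) b.tgt -
          ((gCubeR hPd n c M (P.spacing k ^ 2) (B1.aSeq a P.L k)).map Complex.ofRealHom *ᵥ
            fun y => (starRingEnd ℂ) (toC (h y)) * f y) b.src)) := by
  rw [covD, gBox_cube_pureGauge_mulVec hPd hk1 hk hn hfit hN hM ha, gBox_cube_pureGauge_mulVec hPd hk1 hk hn hfit hN hM ha]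
  have hu : cfg (gaugeAct h (1 : GaugeField P 0 U1)) b = toC (h b.src) * (toC (h b.tgt))⁻¹ := by
    show toC (gaugeAct h 1 b) = _
    rw [toC_gaugeAct]
    show toC (h b.src) * toC 1 * (toC (h b.tgt))⁻¹ = _
    rw [toC_one, mul_one]
  rw [hu]
  have ht : toC (h b.tgt) ≠ 0 := toC_ne_zero _
  field_simp

/-- kernel: a difference version of the real/imaginary part split — `‖z − w‖ ≤ |Re z − Re w| + |Im z − Im w|`. [folklore] -/
private theorem norm_sub_le_re_im (z w : ℂ) : ‖z - w‖ ≤ |z.re - w.re| + |z.im - w.im| := by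
  have h := Complex.norm_le_abs_re_add_abs_im (z - w)
  rwa [Complex.sub_re, Complex.sub_im] at h

/-- **[6] (1.10), COVARIANT-DERIVATIVE MEMBER, FOR THE CUBE PROPAGATORS OF RECORD AT EVERY PURE-GAUGE BACKGROUND** (*"|(D^η_{A,μ}G_k(Ω, A)f)(x)|
≤ c₀exp(−δ₀ dist(x, supp f))‖f‖_∞ (1.10) … for rectangular parallelepipeds … without any restrictions on the points"*, p. 573; the p. 263 sentence
*"Bounds analogous to (2.30), (2.31) hold for covariant derivatives … of G_{k,loc}(u) of order less than two"*): there are `δ₀, c₀ > 0` depending on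
`(d, ℓ, a)` only such that, for all data as in `decay110_flat_cube` and every bond `⟨x, x+e_μ⟩` OF THE CUBE (both end-points in `□`; the Neumann
operator lives on `□`): `‖ε⁻¹(u_{⟨x,x+e_μ⟩}(G f)(x+e_μ) − (G f)(x))‖ ≤ c₀e^{−δ₀εD}F`, `u = 1^h`, `G = G_k(□,1^h)` (r18's `covD`) — from p38's zero-field
BOX theorem `B4Thm110ZeroBoxDeriv.thm110_zero_box_deriv_value` (the `η`-difference quotient member) on the real and imaginary parts of `h̄f` read
in the box, through `covD_gBox_cube_pureGauge` (`ε⁻¹·(L^kε)²·(…) = (L^kε)·L^k(…)`, `L^kε ≤ 1`). [cite: Balaban1983RegularityDecay, (1.10) p.573] -/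
theorem decay110_flat_cube_deriv (d ℓ : ℕ) (hℓ : 1 ≤ ℓ) {a : ℝ} (ha : 0 < a) :
    ∃ δ₀ c₀ : ℝ, 0 < δ₀ ∧ 0 < c₀ ∧ ∀ (P : Params) (hPd : P.d = d + 1), P.L = ℓ + 1 →
      ∀ k : ℕ, 1 ≤ k → k ≤ P.K → ∀ (c M : Fin (d + 1) → ℕ), (∀ i, 1 ≤ M i) →
        (∀ i, c i * P.L ^ k + P.L ^ k * M i ≤ P.sitesPerDir 0) → (∀ i, P.L ^ k * M i < P.sitesPerDir 0) →
        ∀ (h : GaugeTransf P 0 U1) (x : Balaban1983to89.Site P 0) (f : Balaban1983to89.Site P 0 → ℂ) (F D : ℝ),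
          (∀ y, ‖f y‖ ≤ F) → 0 ≤ D → (∀ y, f y ≠ 0 → D ≤ B5Ineq137Torus.T P 0 x y) →
          ∀ μ : Fin P.d, x ∈ cubeT hPd (P.L ^ k) c (fun i => P.L ^ k * M i) →
            x.shift μ ∈ cubeT hPd (P.L ^ k) c (fun i => P.L ^ k * M i) →
            ‖covD P.eps⁻¹ (cfg (gaugeAct h (1 : GaugeField P 0 U1)))
                (gBox (B1RG242Torus.α P a k * (P.L : ℝ) ^ (k * P.d)) P.eps⁻¹ (gaugeAct h (1 : GaugeField P 0 U1)) k
                  (cubeT hPd (P.L ^ k) c fun i => P.L ^ k * M i) *ᵥ f) ⟨x, μ⟩‖ ≤ c₀ * Real.exp (-(δ₀ * (P.eps * D))) * F := by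
  obtain ⟨δ₀, c₀, hδ₀, hc₀, H⟩ := B4Thm110ZeroBoxDeriv.thm110_zero_box_deriv_value d ℓ hℓ a a 0 ha
  refine ⟨δ₀, 2 * c₀, hδ₀, by positivity, ?_⟩
  intro P hPd hPL k hk1 hkK c M hM hfit hN h x f F D hF hD hsupp μ hx hxe
  have hk : k ≤ P.m + P.K := hkK.trans (Nat.le_add_left _ _)
  have e1 : P.L ^ k = (ℓ + 1) ^ k := by rw [hPL]
  rw [e1] at hfit hN hx hxe ⊢
  have hn : (ℓ + 1) ^ k = P.L ^ k := e1.symm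
  have hF0 : 0 ≤ F := (norm_nonneg _).trans (hF x)
  have hncast : (((ℓ + 1) ^ k : ℕ) : ℝ) = (P.L : ℝ) ^ k := by rw [hn]; push_cast; rfl
  have hnpos : (0 : ℝ) < (((ℓ + 1) ^ k : ℕ) : ℝ) := by positivity
  -- the exponent: `L^kε ≤ 1`, so `εD ≤ D/L^k`
  have hs1 : P.spacing k ≤ 1 := by rw [← P.spacing_K]; exact B4Ineq116Torus.spacing_le_spacing P hkK
  have hexp : Real.exp (-(δ₀ * D / (((ℓ + 1) ^ k : ℕ) : ℝ))) ≤ Real.exp (-(δ₀ * (P.eps * D))) := by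
    rw [Real.exp_le_exp, neg_le_neg_iff, mul_div_assoc]
    refine mul_le_mul_of_nonneg_left ?_ hδ₀.le
    rw [le_div_iff₀ hnpos, hncast]
    calc P.eps * D * (P.L : ℝ) ^ k = P.spacing k * D := by rw [Params.spacing]; ring
      _ ≤ 1 * D := mul_le_mul_of_nonneg_right hs1 hD
      _ = D := one_mul D
  -- the scales: `ε⁻¹·(L^kε)² = (L^kε)·L^k`
  have hscale : P.eps⁻¹ * P.spacing k ^ 2 = P.spacing k * (((ℓ + 1) ^ k : ℕ) : ℝ) := by
    rw [hncast, Params.spacing]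
    have hε : P.eps ≠ 0 := P.eps_pos.ne'
    field_simp
  -- [6]'s box theorem, read with `L = ℓ + 1`
  have hLcast : ((ℓ : ℝ) + 1) = (P.L : ℝ) := by rw [hPL]; push_cast; ring
  have H' := H k hk1 a 0 le_rfl le_rfl le_rfl le_rfl M hM
  rw [hLcast] at H'
  -- the two end-points of the bond in the box
  obtain ⟨z, hz, rfl⟩ := (mem_cubeT hPd).1 hx
  have hze : z + Pi.single (Fin.cast hPd μ) 1 ∈ boxDom (fun i => (ℓ + 1) ^ k * M i) := (shift_cubePt_mem_iff hPd hN hz μ).1 hxe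
  have hshift : (cubePt hPd ((ℓ + 1) ^ k) c z).shift μ = cubePt hPd ((ℓ + 1) ^ k) c (z + Pi.single (Fin.cast hPd μ) 1) := by
    rw [cubePt_add_single]
    congr 1
  -- the real estimate for a real source `φ` supported like `f`
  have key : ∀ φ : Balaban1983to89.Site P 0 → ℝ, (∀ y, |φ y| ≤ F) →
      (∀ y, φ y ≠ 0 → D ≤ B5Ineq137Torus.T P 0 (cubePt hPd ((ℓ + 1) ^ k) c z) y) →
      P.eps⁻¹ * |(gCubeR hPd ((ℓ + 1) ^ k) c M (P.spacing k ^ 2) (B1.aSeq a P.L k) *ᵥ φ)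
            (cubePt hPd ((ℓ + 1) ^ k) c (z + Pi.single (Fin.cast hPd μ) 1)) -
          (gCubeR hPd ((ℓ + 1) ^ k) c M (P.spacing k ^ 2) (B1.aSeq a P.L k) *ᵥ φ) (cubePt hPd ((ℓ + 1) ^ k) c z)| ≤
        c₀ * Real.exp (-(δ₀ * (P.eps * D))) * F := by
    intro φ hφ hφs
    rw [gCubeR_mulVec_cubePt hPd hfit _ _ φ hze, gCubeR_mulVec_cubePt hPd hfit _ _ φ hz, ← mul_sub, abs_mul,
      abs_of_nonneg (sq_nonneg _), ← mul_assoc, hscale, mul_assoc, ← abs_of_pos hnpos, ← abs_mul]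
    have hB := H' (fun v => φ (cubePt hPd ((ℓ + 1) ^ k) c (v : Fin (d + 1) → ℤ))) F D (fun v => hφ _) (Fin.cast hPd μ)
      ⟨z, hz⟩ ⟨z + Pi.single (Fin.cast hPd μ) 1, hze⟩ rfl (fun v hv => (hφs _ hv).trans (T_cubePt_le hPd hfit hz v.2))
    calc P.spacing k * |(((ℓ + 1) ^ k : ℕ) : ℝ) *
            ((((boxOpR ((ℓ + 1) ^ k) (B1.aSeq a P.L k) 0 M)⁻¹) *ᵥ fun v => φ (cubePt hPd ((ℓ + 1) ^ k) c (v : Fin (d + 1) → ℤ)))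
                ⟨z + Pi.single (Fin.cast hPd μ) 1, hze⟩ -
              (((boxOpR ((ℓ + 1) ^ k) (B1.aSeq a P.L k) 0 M)⁻¹) *ᵥ fun v => φ (cubePt hPd ((ℓ + 1) ^ k) c (v : Fin (d + 1) → ℤ)))
                ⟨z, hz⟩)|
        ≤ 1 * (c₀ * Real.exp (-(δ₀ * D / (((ℓ + 1) ^ k : ℕ) : ℝ))) * F) :=
          mul_le_mul hs1 hB (abs_nonneg _) zero_le_one
      _ ≤ c₀ * Real.exp (-(δ₀ * (P.eps * D))) * F := by
          rw [one_mul]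
          exact mul_le_mul_of_nonneg_right (mul_le_mul_of_nonneg_left hexp hc₀.le) hF0
  -- pure gauge, the bridge, and the real/imaginary split of `h̄f`
  rw [covD_gBox_cube_pureGauge hPd hk1 hk hn hfit hN hM ha, norm_mul, norm_toC, one_mul, norm_mul, Complex.norm_real,
    Real.norm_eq_abs, abs_of_pos (inv_pos.mpr P.eps_pos)]
  set g : Balaban1983to89.Site P 0 → ℂ := fun y => (starRingEnd ℂ) (toC (h y)) * f y with hg
  have hgR : ∀ y, |(g y).re| ≤ F := fun y => ((Complex.abs_re_le_norm _).trans_eq (norm_rot h f y)).trans (hF y)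
  have hgI : ∀ y, |(g y).im| ≤ F := fun y => ((Complex.abs_im_le_norm _).trans_eq (norm_rot h f y)).trans (hF y)
  have hsR : ∀ y, (g y).re ≠ 0 → D ≤ B5Ineq137Torus.T P 0 (cubePt hPd ((ℓ + 1) ^ k) c z) y := fun y hy =>
    hsupp y fun hf => hy (by simp only [hg, hf, mul_zero, Complex.zero_re])
  have hsI : ∀ y, (g y).im ≠ 0 → D ≤ B5Ineq137Torus.T P 0 (cubePt hPd ((ℓ + 1) ^ k) c z) y := fun y hy =>
    hsupp y fun hf => hy (by simp only [hg, hf, mul_zero, Complex.zero_im])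
  have hE2 : 2 * c₀ * Real.exp (-(δ₀ * (P.eps * D))) * F =
      c₀ * Real.exp (-(δ₀ * (P.eps * D))) * F + c₀ * Real.exp (-(δ₀ * (P.eps * D))) * F := by ring
  rw [hE2]
  have hsrc : (⟨cubePt hPd ((ℓ + 1) ^ k) c z, μ⟩ : PBond P 0).src = cubePt hPd ((ℓ + 1) ^ k) c z := rfl
  have htgt : (⟨cubePt hPd ((ℓ + 1) ^ k) c z, μ⟩ : PBond P 0).tgt = cubePt hPd ((ℓ + 1) ^ k) c (z + Pi.single (Fin.cast hPd μ) 1) :=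
    hshift
  rw [hsrc, htgt]
  refine (mul_le_mul_of_nonneg_left (norm_sub_le_re_im _ _) (inv_pos.mpr P.eps_pos).le).trans ?_
  rw [re_map_mulVec, re_map_mulVec, im_map_mulVec, im_map_mulVec, mul_add]
  exact add_le_add (key _ hgR hsR) (key _ hgI hsI)

end Deriv

/-! ## §7 (2.27)/(2.28): the convex combinations `G̃_k(1^h)`, `G_{k,loc}(1^h)` over no-wrap cubes inherit the kernel decay -/

section ConvexCombination

/-- **KERNEL DECAY OF (2.27) `G̃_k(u) = Σ_α λ_αG_k(□_α,u)` AT EVERY PURE-GAUGE BACKGROUND** — for gen 15's torus object of record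
`BIJ88DeltaLoc234Torus.gTilde` over ANY finite family of no-wrap cubes `□_α = c_α·L^k + Π_i[0, L^kM_{α,i})` shorter than the torus and ANY real
weights with `Σ_α|λ_α(x₁,x₂)| ≤ 1` (convex weights in particular): `‖G̃_k(1^h; x₁, x₂)‖ ≤ c₀e^{−δ₀ε|x₁−x₂|_T}`, constants from `(d, ℓ, a)` — the
*"|G(x,y)| ≤ Ae^{−c dist}"* input shape of p02's (2.30) hence-step (`BIJ88OpDecay230Proof`), from `decay110_flat_cube_kernel` cube by cube.
[cite: BalabanImbrieJaffe1988, (2.27) p.263] -/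
theorem decay_gTilde_flat_kernel (d ℓ : ℕ) (hℓ : 1 ≤ ℓ) {a : ℝ} (ha : 0 < a) :
    ∃ δ₀ c₀ : ℝ, 0 < δ₀ ∧ 0 < c₀ ∧ ∀ (P : Params) (hPd : P.d = d + 1), P.L = ℓ + 1 →
      ∀ k : ℕ, 1 ≤ k → k ≤ P.K → ∀ (ι : Type) [Fintype ι] (cube : ι → Finset (Balaban1983to89.Site P 0))
        (lam : ι → Balaban1983to89.Site P 0 → Balaban1983to89.Site P 0 → ℝ),
        (∀ α, ∃ c M : Fin (d + 1) → ℕ, (∀ i, 1 ≤ M i) ∧ (∀ i, c i * P.L ^ k + P.L ^ k * M i ≤ P.sitesPerDir 0) ∧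
            (∀ i, P.L ^ k * M i < P.sitesPerDir 0) ∧ cube α = cubeT hPd (P.L ^ k) c fun i => P.L ^ k * M i) →
        (∀ x y, ∑ α, |lam α x y| ≤ 1) →
        ∀ (h : GaugeTransf P 0 U1) (x y : Balaban1983to89.Site P 0),
          ‖BIJ88DeltaLoc234Torus.gTilde (B1RG242Torus.α P a k * (P.L : ℝ) ^ (k * P.d)) P.eps⁻¹ (gaugeAct h (1 : GaugeField P 0 U1)) k
              cube lam x y‖ ≤ c₀ * Real.exp (-(δ₀ * (P.eps * B5Ineq137Torus.T P 0 x y))) := by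
  obtain ⟨δ₀, c₀, hδ₀, hc₀, H⟩ := decay110_flat_cube_kernel d ℓ hℓ ha
  refine ⟨δ₀, c₀, hδ₀, hc₀, ?_⟩
  intro P hPd hPL k hk1 hkK ι _ cube lam hcube hlam h x y
  rw [BIJ88DeltaLoc234Torus.gTilde_apply]
  have hB : ∀ α, ‖gBox (B1RG242Torus.α P a k * (P.L : ℝ) ^ (k * P.d)) P.eps⁻¹ (gaugeAct h (1 : GaugeField P 0 U1)) k (cube α) x y‖ ≤
      c₀ * Real.exp (-(δ₀ * (P.eps * B5Ineq137Torus.T P 0 x y))) := fun α => by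
    obtain ⟨c, M, hM, hfit, hN, hc⟩ := hcube α
    rw [hc]
    exact H P hPd hPL k hk1 hkK c M hM hfit hN h x y
  have hE : 0 ≤ c₀ * Real.exp (-(δ₀ * (P.eps * B5Ineq137Torus.T P 0 x y))) := by positivity
  calc ‖∑ α, (lam α x y : ℂ) *
          gBox (B1RG242Torus.α P a k * (P.L : ℝ) ^ (k * P.d)) P.eps⁻¹ (gaugeAct h (1 : GaugeField P 0 U1)) k (cube α) x y‖
      ≤ ∑ α, ‖(lam α x y : ℂ) *
          gBox (B1RG242Torus.α P a k * (P.L : ℝ) ^ (k * P.d)) P.eps⁻¹ (gaugeAct h (1 : GaugeField P 0 U1)) k (cube α) x y‖ :=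
        norm_sum_le _ _
    _ ≤ ∑ α, |lam α x y| * (c₀ * Real.exp (-(δ₀ * (P.eps * B5Ineq137Torus.T P 0 x y)))) := by
        refine sum_le_sum fun α _ => ?_
        rw [norm_mul, Complex.norm_real, Real.norm_eq_abs]
        exact mul_le_mul_of_nonneg_left (hB α) (abs_nonneg _)
    _ = (∑ α, |lam α x y|) * (c₀ * Real.exp (-(δ₀ * (P.eps * B5Ineq137Torus.T P 0 x y)))) := by rw [Finset.sum_mul]
    _ ≤ 1 * (c₀ * Real.exp (-(δ₀ * (P.eps * B5Ineq137Torus.T P 0 x y)))) := mul_le_mul_of_nonneg_right (hlam x y) hE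
    _ = c₀ * Real.exp (-(δ₀ * (P.eps * B5Ineq137Torus.T P 0 x y))) := one_mul _

/-- **KERNEL DECAY OF (2.28) `G_{k,loc}(u) = ζ″_kG̃_k(u)` AT EVERY PURE-GAUGE BACKGROUND** — for gen 15's `BIJ88DeltaLoc234Torus.gLocT` with ANY
real cut-off `|ζ″| ≤ 1`, cubes and weights as in `decay_gTilde_flat_kernel`: `‖G_{k,loc}(1^h; x₁, x₂)‖ ≤ c₀e^{−δ₀ε|x₁−x₂|_T}`.
[cite: BalabanImbrieJaffe1988, (2.28) p.263] -/
theorem decay_gLocT_flat_kernel (d ℓ : ℕ) (hℓ : 1 ≤ ℓ) {a : ℝ} (ha : 0 < a) :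
    ∃ δ₀ c₀ : ℝ, 0 < δ₀ ∧ 0 < c₀ ∧ ∀ (P : Params) (hPd : P.d = d + 1), P.L = ℓ + 1 →
      ∀ k : ℕ, 1 ≤ k → k ≤ P.K → ∀ (ι : Type) [Fintype ι] (cube : ι → Finset (Balaban1983to89.Site P 0))
        (lam : ι → Balaban1983to89.Site P 0 → Balaban1983to89.Site P 0 → ℝ)
        (ζ'' : Balaban1983to89.Site P 0 → Balaban1983to89.Site P 0 → ℝ),
        (∀ α, ∃ c M : Fin (d + 1) → ℕ, (∀ i, 1 ≤ M i) ∧ (∀ i, c i * P.L ^ k + P.L ^ k * M i ≤ P.sitesPerDir 0) ∧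
            (∀ i, P.L ^ k * M i < P.sitesPerDir 0) ∧ cube α = cubeT hPd (P.L ^ k) c fun i => P.L ^ k * M i) →
        (∀ x y, ∑ α, |lam α x y| ≤ 1) → (∀ x y, |ζ'' x y| ≤ 1) →
        ∀ (h : GaugeTransf P 0 U1) (x y : Balaban1983to89.Site P 0),
          ‖BIJ88DeltaLoc234Torus.gLocT (B1RG242Torus.α P a k * (P.L : ℝ) ^ (k * P.d)) P.eps⁻¹ (gaugeAct h (1 : GaugeField P 0 U1)) k
              cube lam ζ'' x y‖ ≤ c₀ * Real.exp (-(δ₀ * (P.eps * B5Ineq137Torus.T P 0 x y))) := by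
  obtain ⟨δ₀, c₀, hδ₀, hc₀, H⟩ := decay_gTilde_flat_kernel d ℓ hℓ ha
  refine ⟨δ₀, c₀, hδ₀, hc₀, ?_⟩
  intro P hPd hPL k hk1 hkK ι _ cube lam ζ'' hcube hlam hζ h x y
  rw [BIJ88DeltaLoc234Torus.gLocT_apply, norm_mul, Complex.norm_real, Real.norm_eq_abs]
  have hG := H P hPd hPL k hk1 hkK ι cube lam hcube hlam h x y
  calc |ζ'' x y| * ‖BIJ88DeltaLoc234Torus.gTilde (B1RG242Torus.α P a k * (P.L : ℝ) ^ (k * P.d)) P.eps⁻¹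
          (gaugeAct h (1 : GaugeField P 0 U1)) k cube lam x y‖
      ≤ 1 * (c₀ * Real.exp (-(δ₀ * (P.eps * B5Ineq137Torus.T P 0 x y)))) := mul_le_mul (hζ x y) hG (norm_nonneg _) zero_le_one
    _ = c₀ * Real.exp (-(δ₀ * (P.eps * B5Ineq137Torus.T P 0 x y))) := one_mul _

end ConvexCombination

/-! ## §8 [6]'s Theorem (1.9), the Hölder member, for `G_k(□, 1^h)` on the bonds of a cube shorter than half the torus -/

section Holder

variable (hPd : P.d = d + 1) {n : ℕ} {c : Fin (d + 1) → ℕ}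

/-- kernel: for two points of a cube shorter than HALF the torus in every direction the torus sup-distance IS the box sup-distance
(`dist(t, Nℤ) = |t|` for `2|t| ≤ N`). [cite: Balaban1983RegularityDecay, p.572, dictionary] -/
theorem T_cubePt_eq {N : Fin (d + 1) → ℕ} (hfit : ∀ i, c i * n + N i ≤ P.sitesPerDir 0) (hhalf : ∀ i, 2 * N i ≤ P.sitesPerDir 0)
    {z v : Fin (d + 1) → ℤ} (hz : z ∈ boxDom N) (hv : v ∈ boxDom N) :
    B5Ineq137Torus.T P 0 (cubePt hPd n c z) (cubePt hPd n c v) = supNorm (z - v) := by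
  refine le_antisymm (T_cubePt_le hPd hfit hz hv) ?_
  obtain ⟨i, hi⟩ := B4ContourShift.exists_supNorm_eq (z - v)
  rw [hi]
  unfold B5Ineq137Torus.T B4Sect5Torus.tdist
  have h1 := B4Sect5Torus.ccoord_cast (B5Ineq137Torus.Nv_pos P 0) (B5Ineq137Torus.toT (cubePt hPd n c z))
    (B5Ineq137Torus.toT (cubePt hPd n c v)) (Fin.cast hPd.symm i)
  have ht : ((((B5Ineq137Torus.toT (cubePt hPd n c z)) (Fin.cast hPd.symm i)).val : ℤ) -
      (((B5Ineq137Torus.toT (cubePt hPd n c v)) (Fin.cast hPd.symm i)).val : ℤ)) = (z - v) i := by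
    show (((cubePt hPd n c z) (Fin.cast hPd.symm i)).val : ℤ) - (((cubePt hPd n c v) (Fin.cast hPd.symm i)).val : ℤ) = _
    rw [val_cubePt hPd hfit hz, val_cubePt hPd hfit hv, Pi.sub_apply, cast_cast]
    ring
  have hcen : 2 * |(z - v) i| ≤ (B5Ineq137Torus.Nv P 0 (Fin.cast hPd.symm i) : ℤ) := by
    show 2 * |(z - v) i| ≤ ((P.sitesPerDir 0 : ℕ) : ℤ)
    have hzi := (mem_boxDom.1 hz) i; have hvi := (mem_boxDom.1 hv) i
    have hh : ((2 * N i : ℕ) : ℤ) ≤ ((P.sitesPerDir 0 : ℕ) : ℤ) := by exact_mod_cast hhalf i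
    have hlt : |z i - v i| < N i := abs_sub_lt_iff.2 ⟨by omega, by omega⟩
    rw [Pi.sub_apply]
    push_cast at hh
    linarith
  rw [ht, B4TorusKernel.MultiPeriod.circAbs_of_centred (B5Ineq137Torus.Nv_pos P 0 _) hcen] at h1
  have h2 : B4Sect5Torus.ccoord (B5Ineq137Torus.Nv P 0) (B5Ineq137Torus.toT (cubePt hPd n c z))
      (B5Ineq137Torus.toT (cubePt hPd n c v)) (Fin.cast hPd.symm i) ≤
        Finset.univ.sup (B4Sect5Torus.ccoord (B5Ineq137Torus.Nv P 0) (B5Ineq137Torus.toT (cubePt hPd n c z))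
          (B5Ineq137Torus.toT (cubePt hPd n c v))) := Finset.le_sup (Finset.mem_univ _)
  have h3 : ((|(z - v) i| : ℤ) : ℝ) = ((B4Sect5Torus.ccoord (B5Ineq137Torus.Nv P 0) (B5Ineq137Torus.toT (cubePt hPd n c z))
      (B5Ineq137Torus.toT (cubePt hPd n c v)) (Fin.cast hPd.symm i) : ℕ) : ℝ) := by
    exact_mod_cast h1.symm
  rw [h3]
  exact_mod_cast h2

/-- **[6] (1.9), THE HÖLDER MEMBER, FOR THE CUBE PROPAGATORS OF RECORD AT EVERY PURE-GAUGE BACKGROUND** (*"For α < 1 there exist positive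
constants δ₀, c₀ … |x − x′|^{−α}|U(A(Γ_{x,x′}))(D^η_{A,μ}G_k(Ω, A)f)(x′) − (D^η_{A,μ}G_k(Ω, A)f)(x)| ≤ c₀exp(−δ₀ dist({x, x′}, supp f))‖f‖_∞
(1.9) … for rectangular parallelepipeds, the inequalities hold without any restrictions on the points"*, p. 573): for every `0 ≤ α < 1` there are
`δ₀, c₀ > 0` depending on `(d, ℓ, a, α)` only such that, for all data as in `decay110_flat_cube` with the cube shorter than HALF the torus
(`2L^kM_i ≤ |T|`, so that torus and box distances of cube points agree, `T_cubePt_eq`), every direction `μ` and all pairs of bonds `⟨x₁,x₁+e_μ⟩`,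
`⟨x₂,x₂+e_μ⟩` of the cube with `x₁ ≠ x₂`, both points at sup-torus distance `≥ D ≥ 0` from `supp f`:
`(L^k/|x₁−x₂|_T)^α·‖u(Γ_{x₁x₂})(D_uG f)(x₂,μ) − (D_uG f)(x₁,μ)‖ ≤ c₀e^{−δ₀εD}F`, where at the pure-gauge background `u = 1^h` the parallel
transport along ANY contour from `x₂` to `x₁` is `h(x₁)h(x₂)^{−1}` (written out), `(D_uG f)(x,μ) = ε⁻¹(u_{⟨x,x+e_μ⟩}(G f)(x+e_μ) − (G f)(x))`
and `|x₁−x₂|/L^k` is the printed distance in [6]'s level-`k` units (`= ε|x₁−x₂|_T` at the unit block lattice `k = K`) — from p38's zero-field BOX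
theorem `B4Thm19ZeroBoxHolder.thm19_zero_box_holder_value` on the real and imaginary parts of `h̄f` read in the box.
[cite: Balaban1983RegularityDecay, (1.9) p.573] -/
theorem holder19_flat_cube (d ℓ : ℕ) (hℓ : 1 ≤ ℓ) {a : ℝ} (ha : 0 < a) {α : ℝ} (hα0 : 0 ≤ α) (hα1 : α < 1) :
    ∃ δ₀ c₀ : ℝ, 0 < δ₀ ∧ 0 < c₀ ∧ ∀ (P : Params) (hPd : P.d = d + 1), P.L = ℓ + 1 →
      ∀ k : ℕ, 1 ≤ k → k ≤ P.K → ∀ (c M : Fin (d + 1) → ℕ), (∀ i, 1 ≤ M i) →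
        (∀ i, c i * P.L ^ k + P.L ^ k * M i ≤ P.sitesPerDir 0) → (∀ i, 2 * (P.L ^ k * M i) ≤ P.sitesPerDir 0) →
        ∀ (h : GaugeTransf P 0 U1) (μ : Fin P.d) (x₁ x₂ : Balaban1983to89.Site P 0), x₂ ≠ x₁ →
          x₁ ∈ cubeT hPd (P.L ^ k) c (fun i => P.L ^ k * M i) → x₁.shift μ ∈ cubeT hPd (P.L ^ k) c (fun i => P.L ^ k * M i) →
          x₂ ∈ cubeT hPd (P.L ^ k) c (fun i => P.L ^ k * M i) → x₂.shift μ ∈ cubeT hPd (P.L ^ k) c (fun i => P.L ^ k * M i) →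
        ∀ (f : Balaban1983to89.Site P 0 → ℂ) (F D : ℝ), (∀ z, ‖f z‖ ≤ F) → 0 ≤ D →
          (∀ z, f z ≠ 0 → D ≤ B5Ineq137Torus.T P 0 x₁ z) → (∀ z, f z ≠ 0 → D ≤ B5Ineq137Torus.T P 0 x₂ z) →
            ((P.L : ℝ) ^ k / B5Ineq137Torus.T P 0 x₁ x₂) ^ α *
              ‖toC (h x₁) * (toC (h x₂))⁻¹ *
                  covD P.eps⁻¹ (cfg (gaugeAct h (1 : GaugeField P 0 U1)))
                    (gBox (B1RG242Torus.α P a k * (P.L : ℝ) ^ (k * P.d)) P.eps⁻¹ (gaugeAct h (1 : GaugeField P 0 U1)) k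
                      (cubeT hPd (P.L ^ k) c fun i => P.L ^ k * M i) *ᵥ f) ⟨x₂, μ⟩ -
                covD P.eps⁻¹ (cfg (gaugeAct h (1 : GaugeField P 0 U1)))
                    (gBox (B1RG242Torus.α P a k * (P.L : ℝ) ^ (k * P.d)) P.eps⁻¹ (gaugeAct h (1 : GaugeField P 0 U1)) k
                      (cubeT hPd (P.L ^ k) c fun i => P.L ^ k * M i) *ᵥ f) ⟨x₁, μ⟩‖
              ≤ c₀ * Real.exp (-(δ₀ * (P.eps * D))) * F := by
  obtain ⟨δ₀, c₀, hδ₀, hc₀, H⟩ := B4Thm19ZeroBoxHolder.thm19_zero_box_holder_value d ℓ hℓ a a 0 ha α hα0 hα1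
  refine ⟨δ₀, 2 * c₀, hδ₀, by positivity, ?_⟩
  intro P hPd hPL k hk1 hkK c M hM hfit hhalf h μ x₁ x₂ hne hx₁ hx₁e hx₂ hx₂e f F D hF hD hs₁ hs₂
  have hk : k ≤ P.m + P.K := hkK.trans (Nat.le_add_left _ _)
  have e1 : P.L ^ k = (ℓ + 1) ^ k := by rw [hPL]
  rw [e1] at hfit hhalf hx₁ hx₁e hx₂ hx₂e ⊢
  have hn : (ℓ + 1) ^ k = P.L ^ k := e1.symm
  have hn1 : 1 ≤ (ℓ + 1) ^ k := Nat.one_le_pow _ _ (by omega)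
  have hN : ∀ i, (ℓ + 1) ^ k * M i < P.sitesPerDir 0 := fun i => by
    have := hhalf i; have := hM i; have : 1 ≤ (ℓ + 1) ^ k * M i := Nat.one_le_iff_ne_zero.2 (by positivity); omega
  have hF0 : 0 ≤ F := (norm_nonneg _).trans (hF x₁)
  have hncast : (((ℓ + 1) ^ k : ℕ) : ℝ) = (P.L : ℝ) ^ k := by rw [hn]; push_cast; rfl
  have hnpos : (0 : ℝ) < (((ℓ + 1) ^ k : ℕ) : ℝ) := by positivity
  have hs1 : P.spacing k ≤ 1 := by rw [← P.spacing_K]; exact B4Ineq116Torus.spacing_le_spacing P hkK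
  have hexp : Real.exp (-(δ₀ * D / (((ℓ + 1) ^ k : ℕ) : ℝ))) ≤ Real.exp (-(δ₀ * (P.eps * D))) := by
    rw [Real.exp_le_exp, neg_le_neg_iff, mul_div_assoc]
    refine mul_le_mul_of_nonneg_left ?_ hδ₀.le
    rw [le_div_iff₀ hnpos, hncast]
    calc P.eps * D * (P.L : ℝ) ^ k = P.spacing k * D := by rw [Params.spacing]; ring
      _ ≤ 1 * D := mul_le_mul_of_nonneg_right hs1 hD
      _ = D := one_mul D
  have hscale : P.eps⁻¹ * P.spacing k ^ 2 = P.spacing k * (((ℓ + 1) ^ k : ℕ) : ℝ) := by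
    rw [hncast, Params.spacing]
    have hε : P.eps ≠ 0 := P.eps_pos.ne'
    field_simp
  have hLcast : ((ℓ : ℝ) + 1) = (P.L : ℝ) := by rw [hPL]; push_cast; ring
  have H' := H k hk1 a 0 le_rfl le_rfl le_rfl le_rfl M hM
  rw [hLcast] at H'
  -- the four points in the box
  obtain ⟨z₁, hz₁, rfl⟩ := (mem_cubeT hPd).1 hx₁
  obtain ⟨z₂, hz₂, rfl⟩ := (mem_cubeT hPd).1 hx₂
  have hz₁e : z₁ + Pi.single (Fin.cast hPd μ) 1 ∈ boxDom (fun i => (ℓ + 1) ^ k * M i) := (shift_cubePt_mem_iff hPd hN hz₁ μ).1 hx₁e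
  have hz₂e : z₂ + Pi.single (Fin.cast hPd μ) 1 ∈ boxDom (fun i => (ℓ + 1) ^ k * M i) := (shift_cubePt_mem_iff hPd hN hz₂ μ).1 hx₂e
  have hshift : ∀ z : Fin (d + 1) → ℤ,
      (cubePt hPd ((ℓ + 1) ^ k) c z).shift μ = cubePt hPd ((ℓ + 1) ^ k) c (z + Pi.single (Fin.cast hPd μ) 1) := fun z => by
    rw [cubePt_add_single]
    congr 1
  have hzne : z₂ ≠ z₁ := fun e => hne (by rw [e])
  -- the weight: torus distance = box distance for a cube shorter than half the torus
  have hT : B5Ineq137Torus.T P 0 (cubePt hPd ((ℓ + 1) ^ k) c z₁) (cubePt hPd ((ℓ + 1) ^ k) c z₂) = supNorm (z₂ - z₁) := by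
    rw [B5Ineq137Torus.T_symm, T_cubePt_eq hPd hfit hhalf hz₂ hz₁]
  have hW : ((P.L : ℝ) ^ k / B5Ineq137Torus.T P 0 (cubePt hPd ((ℓ + 1) ^ k) c z₁) (cubePt hPd ((ℓ + 1) ^ k) c z₂)) ^ α =
      ((((ℓ + 1) ^ k : ℕ) : ℝ) / supNorm (z₂ - z₁)) ^ α := by rw [hT, hncast]
  have hW0 : 0 ≤ ((((ℓ + 1) ^ k : ℕ) : ℝ) / supNorm (z₂ - z₁)) ^ α :=
    Real.rpow_nonneg (div_nonneg (Nat.cast_nonneg _) (supNorm_nonneg _)) α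
  rw [hW]
  -- the real estimate for a real source `φ` supported like `f`
  have key : ∀ φ : Balaban1983to89.Site P 0 → ℝ, (∀ y, |φ y| ≤ F) →
      (∀ y, φ y ≠ 0 → D ≤ B5Ineq137Torus.T P 0 (cubePt hPd ((ℓ + 1) ^ k) c z₁) y) →
      (∀ y, φ y ≠ 0 → D ≤ B5Ineq137Torus.T P 0 (cubePt hPd ((ℓ + 1) ^ k) c z₂) y) →
      ((((ℓ + 1) ^ k : ℕ) : ℝ) / supNorm (z₂ - z₁)) ^ α *
        |P.eps⁻¹ * ((gCubeR hPd ((ℓ + 1) ^ k) c M (P.spacing k ^ 2) (B1.aSeq a P.L k) *ᵥ φ)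
              (cubePt hPd ((ℓ + 1) ^ k) c (z₂ + Pi.single (Fin.cast hPd μ) 1)) -
            (gCubeR hPd ((ℓ + 1) ^ k) c M (P.spacing k ^ 2) (B1.aSeq a P.L k) *ᵥ φ) (cubePt hPd ((ℓ + 1) ^ k) c z₂)) -
          P.eps⁻¹ * ((gCubeR hPd ((ℓ + 1) ^ k) c M (P.spacing k ^ 2) (B1.aSeq a P.L k) *ᵥ φ)
              (cubePt hPd ((ℓ + 1) ^ k) c (z₁ + Pi.single (Fin.cast hPd μ) 1)) -
            (gCubeR hPd ((ℓ + 1) ^ k) c M (P.spacing k ^ 2) (B1.aSeq a P.L k) *ᵥ φ) (cubePt hPd ((ℓ + 1) ^ k) c z₁))| ≤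
        c₀ * Real.exp (-(δ₀ * (P.eps * D))) * F := by
    intro φ hφ hφ₁ hφ₂
    rw [gCubeR_mulVec_cubePt hPd hfit _ _ φ hz₂e, gCubeR_mulVec_cubePt hPd hfit _ _ φ hz₂, gCubeR_mulVec_cubePt hPd hfit _ _ φ hz₁e,
      gCubeR_mulVec_cubePt hPd hfit _ _ φ hz₁]
    have halg : ∀ A B C E : ℝ, P.eps⁻¹ * (P.spacing k ^ 2 * A - P.spacing k ^ 2 * B) - P.eps⁻¹ * (P.spacing k ^ 2 * C - P.spacing k ^ 2 * E) =
        P.spacing k * ((((ℓ + 1) ^ k : ℕ) : ℝ) * ((A - B) - (C - E))) := fun A B C E => by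
      rw [← mul_assoc (P.spacing k), ← hscale]; ring
    rw [halg, abs_mul, abs_of_pos (P.spacing_pos k), mul_left_comm]
    have hB := H' (fun v => φ (cubePt hPd ((ℓ + 1) ^ k) c (v : Fin (d + 1) → ℤ))) F D (fun v => hφ _) (Fin.cast hPd μ)
      ⟨z₁, hz₁⟩ ⟨z₁ + Pi.single (Fin.cast hPd μ) 1, hz₁e⟩ ⟨z₂, hz₂⟩ ⟨z₂ + Pi.single (Fin.cast hPd μ) 1, hz₂e⟩ rfl rfl hzne
      (fun v hv => le_min ((hφ₁ _ hv).trans (T_cubePt_le hPd hfit hz₁ v.2)) ((hφ₂ _ hv).trans (T_cubePt_le hPd hfit hz₂ v.2)))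
    calc P.spacing k * (((((ℓ + 1) ^ k : ℕ) : ℝ) / supNorm (z₂ - z₁)) ^ α *
          |(((ℓ + 1) ^ k : ℕ) : ℝ) *
            (((((boxOpR ((ℓ + 1) ^ k) (B1.aSeq a P.L k) 0 M)⁻¹) *ᵥ fun v => φ (cubePt hPd ((ℓ + 1) ^ k) c (v : Fin (d + 1) → ℤ)))
                  ⟨z₂ + Pi.single (Fin.cast hPd μ) 1, hz₂e⟩ -
                (((boxOpR ((ℓ + 1) ^ k) (B1.aSeq a P.L k) 0 M)⁻¹) *ᵥ fun v => φ (cubePt hPd ((ℓ + 1) ^ k) c (v : Fin (d + 1) → ℤ)))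
                  ⟨z₂, hz₂⟩) -
              ((((boxOpR ((ℓ + 1) ^ k) (B1.aSeq a P.L k) 0 M)⁻¹) *ᵥ fun v => φ (cubePt hPd ((ℓ + 1) ^ k) c (v : Fin (d + 1) → ℤ)))
                  ⟨z₁ + Pi.single (Fin.cast hPd μ) 1, hz₁e⟩ -
                (((boxOpR ((ℓ + 1) ^ k) (B1.aSeq a P.L k) 0 M)⁻¹) *ᵥ fun v => φ (cubePt hPd ((ℓ + 1) ^ k) c (v : Fin (d + 1) → ℤ)))
                  ⟨z₁, hz₁⟩))|)
        ≤ 1 * (c₀ * Real.exp (-(δ₀ * D / (((ℓ + 1) ^ k : ℕ) : ℝ))) * F) :=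
          mul_le_mul hs1 hB (mul_nonneg hW0 (abs_nonneg _)) zero_le_one
      _ ≤ c₀ * Real.exp (-(δ₀ * (P.eps * D))) * F := by
          rw [one_mul]
          exact mul_le_mul_of_nonneg_right (mul_le_mul_of_nonneg_left hexp hc₀.le) hF0
  -- remove the phases, split `h̄f` into real and imaginary parts
  set g : Balaban1983to89.Site P 0 → ℂ := fun y => (starRingEnd ℂ) (toC (h y)) * f y with hg
  have hgR : ∀ y, |(g y).re| ≤ F := fun y => ((Complex.abs_re_le_norm _).trans_eq (norm_rot h f y)).trans (hF y)
  have hgI : ∀ y, |(g y).im| ≤ F := fun y => ((Complex.abs_im_le_norm _).trans_eq (norm_rot h f y)).trans (hF y)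
  have hgne : ∀ y, ((g y).re ≠ 0 ∨ (g y).im ≠ 0) → f y ≠ 0 := fun y hy hf => by
    rcases hy with hy | hy
    · exact hy (by simp only [hg, hf, mul_zero, Complex.zero_re])
    · exact hy (by simp only [hg, hf, mul_zero, Complex.zero_im])
  set ψ : Balaban1983to89.Site P 0 → ℂ :=
    (gCubeR hPd ((ℓ + 1) ^ k) c M (P.spacing k ^ 2) (B1.aSeq a P.L k)).map Complex.ofRealHom *ᵥ g with hψ
  set δψ : Balaban1983to89.Site P 0 → ℂ := fun x => ((P.eps⁻¹ : ℝ) : ℂ) * (ψ (x.shift μ) - ψ x) with hδψ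
  have hcov : ∀ x : Balaban1983to89.Site P 0, covD P.eps⁻¹ (cfg (gaugeAct h (1 : GaugeField P 0 U1)))
      (gBox (B1RG242Torus.α P a k * (P.L : ℝ) ^ (k * P.d)) P.eps⁻¹ (gaugeAct h (1 : GaugeField P 0 U1)) k
        (cubeT hPd ((ℓ + 1) ^ k) c fun i => (ℓ + 1) ^ k * M i) *ᵥ f) ⟨x, μ⟩ = toC (h x) * δψ x := fun x => by
    rw [covD_gBox_cube_pureGauge hPd hk1 hk hn hfit hN hM ha]; rfl
  have hx₂' : toC (h (cubePt hPd ((ℓ + 1) ^ k) c z₂)) ≠ 0 := toC_ne_zero _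
  have hphase : toC (h (cubePt hPd ((ℓ + 1) ^ k) c z₁)) * (toC (h (cubePt hPd ((ℓ + 1) ^ k) c z₂)))⁻¹ *
        (toC (h (cubePt hPd ((ℓ + 1) ^ k) c z₂)) * δψ (cubePt hPd ((ℓ + 1) ^ k) c z₂)) -
      toC (h (cubePt hPd ((ℓ + 1) ^ k) c z₁)) * δψ (cubePt hPd ((ℓ + 1) ^ k) c z₁) =
      toC (h (cubePt hPd ((ℓ + 1) ^ k) c z₁)) * (δψ (cubePt hPd ((ℓ + 1) ^ k) c z₂) - δψ (cubePt hPd ((ℓ + 1) ^ k) c z₁)) := by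
    field_simp
  rw [hcov, hcov, hphase, norm_mul, norm_toC, one_mul]
  have hre : ∀ z : Fin (d + 1) → ℤ, (δψ (cubePt hPd ((ℓ + 1) ^ k) c z)).re =
      P.eps⁻¹ * ((gCubeR hPd ((ℓ + 1) ^ k) c M (P.spacing k ^ 2) (B1.aSeq a P.L k) *ᵥ fun y => (g y).re)
          (cubePt hPd ((ℓ + 1) ^ k) c (z + Pi.single (Fin.cast hPd μ) 1)) -
        (gCubeR hPd ((ℓ + 1) ^ k) c M (P.spacing k ^ 2) (B1.aSeq a P.L k) *ᵥ fun y => (g y).re) (cubePt hPd ((ℓ + 1) ^ k) c z)) :=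
    fun z => by simp only [hδψ, hshift z, Complex.re_ofReal_mul, Complex.sub_re, hψ, re_map_mulVec]
  have him : ∀ z : Fin (d + 1) → ℤ, (δψ (cubePt hPd ((ℓ + 1) ^ k) c z)).im =
      P.eps⁻¹ * ((gCubeR hPd ((ℓ + 1) ^ k) c M (P.spacing k ^ 2) (B1.aSeq a P.L k) *ᵥ fun y => (g y).im)
          (cubePt hPd ((ℓ + 1) ^ k) c (z + Pi.single (Fin.cast hPd μ) 1)) -
        (gCubeR hPd ((ℓ + 1) ^ k) c M (P.spacing k ^ 2) (B1.aSeq a P.L k) *ᵥ fun y => (g y).im) (cubePt hPd ((ℓ + 1) ^ k) c z)) :=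
    fun z => by simp only [hδψ, hshift z, Complex.im_ofReal_mul, Complex.sub_im, hψ, im_map_mulVec]
  have E2 : 2 * c₀ * Real.exp (-(δ₀ * (P.eps * D))) * F =
      c₀ * Real.exp (-(δ₀ * (P.eps * D))) * F + c₀ * Real.exp (-(δ₀ * (P.eps * D))) * F := by ring
  calc ((((ℓ + 1) ^ k : ℕ) : ℝ) / supNorm (z₂ - z₁)) ^ α * ‖δψ (cubePt hPd ((ℓ + 1) ^ k) c z₂) - δψ (cubePt hPd ((ℓ + 1) ^ k) c z₁)‖
      ≤ ((((ℓ + 1) ^ k : ℕ) : ℝ) / supNorm (z₂ - z₁)) ^ α *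
          (|(δψ (cubePt hPd ((ℓ + 1) ^ k) c z₂)).re - (δψ (cubePt hPd ((ℓ + 1) ^ k) c z₁)).re| +
            |(δψ (cubePt hPd ((ℓ + 1) ^ k) c z₂)).im - (δψ (cubePt hPd ((ℓ + 1) ^ k) c z₁)).im|) :=
        mul_le_mul_of_nonneg_left (norm_sub_le_re_im _ _) hW0
    _ = ((((ℓ + 1) ^ k : ℕ) : ℝ) / supNorm (z₂ - z₁)) ^ α *
            |(δψ (cubePt hPd ((ℓ + 1) ^ k) c z₂)).re - (δψ (cubePt hPd ((ℓ + 1) ^ k) c z₁)).re| +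
          ((((ℓ + 1) ^ k : ℕ) : ℝ) / supNorm (z₂ - z₁)) ^ α *
            |(δψ (cubePt hPd ((ℓ + 1) ^ k) c z₂)).im - (δψ (cubePt hPd ((ℓ + 1) ^ k) c z₁)).im| := mul_add _ _ _
    _ ≤ c₀ * Real.exp (-(δ₀ * (P.eps * D))) * F + c₀ * Real.exp (-(δ₀ * (P.eps * D))) * F := by
        rw [hre, hre, him, him]
        exact add_le_add
          (key _ hgR (fun y hy => hs₁ y (hgne y (Or.inl hy))) (fun y hy => hs₂ y (hgne y (Or.inl hy))))
          (key _ hgI (fun y hy => hs₁ y (hgne y (Or.inr hy))) (fun y hy => hs₂ y (hgne y (Or.inr hy))))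
    _ = 2 * c₀ * Real.exp (-(δ₀ * (P.eps * D))) * F := E2.symm

end Holder

end

end Literature.MathematicalPhysics.QuantumFieldTheory.BalabanImbrieJaffe1984to88.BIJ88NeumannPropagatorFlatDecayCube
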